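import Literature.MathematicalPhysics.QuantumFieldTheory.Balaban1983to89.B15Prop1CoerciveAtNormalisedDatum
import Literature.MathematicalPhysics.QuantumFieldTheory.Balaban1983to89.B16Ineq17NearFlatWilsonLettersWindow

/-!
# `Balaban1983to89.B15Prop1EndpointNearFlatLettersWindow` — [Balaban1989LargeFieldII] = «[LF-II]», p. 357, (1.7)–(1.9) p. 358, (1.12)–(1.13) p. 359; [Balaban1989LargeFieldI] = «[IV]»,
# (1.74) p. 192, (1.77) and Prop. 1 p. 194; [Balaban1985BackgroundPropagators] (3.8) p. 391, (3.10) p. 392: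
# ★★ THE `h17` CLAUSE AND THE (1.9) COERCIVITY STEP OF THE N12∕s1 CHAIN — WINDOW EDITION («C1_window + P1»): bond-wise near-flatness of `U₀` asked ONLY on a finite window of
# plaquettes, PLAQUETTE smallness `‖U₀(∂p) − 1‖ ≤ ε` on the other plaquettes where the family moves

Honest framing: statement-level skeleton of published theorems with citation tags; proofs where landed; nothing here is a claim about the
Yang–Mills mass gap.  Cell `pub-ymgap`, HUMAN RULING D-0062 ∕ D-0149, seat `pub-ymgap-dag-n12-c` (g20; N12 = [B15], strategy s1, lane owner); count-neutral helper of
K1⁹ `stmt-QuantumFields-27364`; N12 NOT discharged; finite 𝕋⁴ at fixed ε; nothing continuum ∕ OS ∕ mass-gap ∕ Clay.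

WHY (the lane's LOCATED-GEOM v3 memo, option (b) step (C1′)).  J-C v1.2 (`B15Prop1EndpointNearFlatLetters.h17Clause_of_nearFlatLetters_sub_loc`, p618172) and the coercivity step
`B15Prop1CoerciveAtNormalisedDatum.sliceCoercive_of_nearFlatLetters_sub_loc` (p623795) ask the (2.12) minimiser `U₀` to be bond-wise `δ`-near `1` on EVERY plaquette having a bond that
starts in `Ω₁(Z)`.  On a component of `Ω₁(Z)` carrying a non-contractible loop with large holonomy of the datum this is not inhabitable by any gauge (`B15Prop1HolonomyObstruction`,
p637918).  [LF-II] p. 357 foot – p. 358 (1.7) reads the flat `∂*∂`-form and the bound (1.67) [10] on the WINDOW `B^k(Λ₀)` only; off the window the second variation of the Wilson action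
needs only a ONE-SIDED bound, which holds at any background whose PLAQUETTE variables are `ε`-near `1` ([Balaban1985BackgroundPropagators] (3.8) «|U(∂p) − 1| < ε») — a gauge-invariant
letter, the currency of [15] Thm 1 (8).  Dag-n12-w4 typed that Wilson-side re-cut: `Node00.WilsonActionSecondVariationPlaqSmall{,Lattice}` (the per-plaquette ∕ lattice one-sided bounds)
and `B16Ineq17NearFlatWilsonLettersWindow.hessian_wilsonAction4_criticalExpChartFamily_ge_flatMin_sub_window` (the skeleton with the window flat form `B_W`).  THIS MODULE is the lane's
junction at the endpoint's own objects: the `h17` clause and (1.9) at the slice of ONE base field with `hU` ↦ (`hUwin` on a displayed finite window `W` of plaquettes, `hPfar` plaquette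
smallness on the plaquettes meeting `{b | b.src ∈ Ω₁(Z)}` off `W`), the Federbush fibre letter `hm` read against `B_W`, and the assembled constant
`Cerr = (32(d−1)δ + 8(d−1)ε + μ + 16(d−1)ρδ₂(2+ρδ₂))·Kc² + τ`.  Everything else VERBATIM from the `_sub_loc` editions; no family letter ∕ endpoint is re-keyed here (the socket editions
wait for the planner's ruling on the memo's options).

CONTENTS (theorems only; no `def`, no `instance`, no `sorry`).
* §1 ★★ `h17Clause_of_nearFlatLetters_sub_window` — one instance, one base field: the window package ⇒ the `h17` clause for every slice vector `X`.
* §2 ★★ `sliceCoercive_of_nearFlatLetters_sub_window` — the same package + numerics `hsm`∕`hγle` ⇒ (1.9) `γ∕M⁵·‖X‖² ≤ ⟪X, D(∇ sliceFn …)(0) X⟫` at the slice.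
* §3 ★★ `hessian_wilsonAction4_criticalExpChartFamily_ge_direct_sub_window` (generic torus ∕ level ∕ `N`), ★★ `h17Clause_of_windowLetters_direct`, ★★ `sliceCoercive_of_windowLetters_direct`
  — the DIRECT editions: the Federbush letter asked AT THE VELOCITY `X_f′X` (`γ₀·circ X − τ‖X‖² ≤ B_W(X_f′X, X_f′X)`); the flat linearisation `L♭`, its right inverse `R♭`, the size `q`,
  the constants `ρ`, `δ₂` and the row (δ₂) DISAPPEAR from the socket (they only served to move `X_f′X` into `L♭`'s fibre); constant `(32(d−1)δ + 8(d−1)ε + μ)·Kc² + τ`.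
* §4 ★★★ `hcoer_of_windowLettersDirect_gaugeNormalisable` — the FAMILY letter of the direct road (p627443 §5's general-region shape with the package (N) replaced by the window∕direct
  package (WD)): the socket text a producer of the direct road inhabits; conclusion = the `_ofCoercive` chain's `hcoer` verbatim.
* §5 (v1.1) ★★★ `hcoer_of_windowLettersDirect_normalised_box` — the same in p623795 §3's BOX-NORMALISER shape (region parallelepipeds `[LO i, HI i]`, dag-n12-w6's normaliser inside):
  the binder list dag-n12-w5's (ii) `B15Prop1EndpointFromLetterFamiliesLoc` §2 call reads, with `hNFn` ↦ `hWD`.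
HONEST SCOPE: composition by name of landed theorems (dag-n12-w4's window skeleton, this lane's p604041 ∕ p618172 ∕ p623795 steps, dag-n12-w5's support letter); every letter stays
DISPLAYED; the window `W`, `ε` and the `B_W`-Federbush producer are the consumer's; nothing of Bałaban's is asserted.
-/

noncomputable section

open Set Finset Metric Filter
open scoped BigOperators Matrix RealInnerProductSpace Real InnerProductSpace Topology

namespace Literature.MathematicalPhysics.QuantumFieldTheory.Balaban1983to89.B15Prop1EndpointNearFlatLettersWindow

open B15DeterminingSets GaugeField B16Sect1Backgrounds B15Prop1Carrier B8Eq17ClassAkV1 BlockAveraging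
open B15Prop1SliceTaylorCalculus B15Prop1OneSidedIneq17OfFun
open B15Prop1SliceHessianOfChartFamily (eventually_sliceFn_fun177std_bgMSCoPOfRecord_eq_wilsonAction4 h17Shape_of_hessian_chartFamily_ge_sub)
open B16Ineq17NearFlatDatumFamily (haff_msChart_of_isMinimizer_family)
open B16Ineq19FlatSliceChart (exists_lieSU2Coord)
open B15Prop1CoerciveAtNormalisedDatum (hessian_coercive_of_h17_ofDec)
open B16Ineq17NearFlatWilsonLettersWindow (hessian_wilsonAction4_criticalExpChartFamily_ge_flatMin_sub_window)
open B15Prop1ChartCalculusSU2 (E3)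
open T4CubeChartGnomonic (SU2)
open B15Prop1ChartSU2 (su2Chart)
open B15Prop1SliceCoordinates (GaugeSlice ιA freeBonds)
open T4AdjointCovarianceUnitary (lieSU)
open T4AxialGaugeSmallField (castSite boxPlaqs boxBonds)
open B6BondElimination (unitVec)
open B6TreeGaugePoincare (curl)
open B16Eq18Proof (box mem_box)
open B15Extension193 (extend)
open B15ShellGauge193 (shellGauge)
open B14.Eq213DetSet B14.Eq216Concrete B15Sect1Instances B15Eq177GaugeInvariance B15Eq177ValueInvariance B15Eq177ValueInvarianceCoDiv B16Sect1Wilson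
open B14.Eq22Determines (blockIter IsBlockUnion)
open Literature.MathematicalPhysics.QuantumFieldTheory.BalabanImbrieJaffe1984to88.BIJ85Eq453GaugeField
open Node00 (expChart msChart constrCard SU)
open T4Continuum
open scoped Matrix.Norms.L2Operator

/-- `ContDiffAt ℝ 2 X 0` ⇒ `X` has a derivative at `0`, `D X` has a derivative at `0`, and `X` is differentiable near `0` (private plumbing for the skeleton's binders). [folklore] -/
private theorem triple_of_contDiffAt_two {G E : Type*} [NormedAddCommGroup G] [NormedSpace ℝ G] [NormedAddCommGroup E] [NormedSpace ℝ E]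
    {X : G → E} (h : ContDiffAt ℝ 2 X 0) :
    HasFDerivAt X (fderiv ℝ X 0) 0 ∧ HasFDerivAt (fun g => fderiv ℝ X g) (fderiv ℝ (fun g => fderiv ℝ X g) 0) 0 ∧
      ∀ᶠ g in 𝓝 (0 : G), DifferentiableAt ℝ X g := by
  refine ⟨(h.differentiableAt (by norm_num)).hasFDerivAt, ?_, ?_⟩
  · have h1 : ContDiffAt ℝ 1 (fun g => fderiv ℝ X g) 0 := h.fderiv_right (m := 1) (by norm_num)
    exact (h1.differentiableAt (by norm_num)).hasFDerivAt
  · obtain ⟨f', u, hu, -, huf⟩ := contDiffAt_one_iff.1 (h.of_le (by norm_num))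
    filter_upwards [hu] with g hg using (huf g hg).differentiableAt

/-! ## §1  One instance, one base field: the WINDOW package gives the `h17` clause -/

section Window

variable {F : T4Family}

/-- ★★ **THE `h17` CLAUSE FROM THE NEAR-FLAT PACKAGE — WINDOW EDITION («C1_window + P1»)**: as `B15Prop1EndpointNearFlatLetters.h17Clause_of_nearFlatLetters_sub_loc` (the endpoint's own
shapes: slice `GaugeSlice (pts k Λ) T`, base `ext Ṽ_k`, class `regMSCoPOfRecord F 2 ν Kt k (maxDomT ν.M₁ Z)`, determining set `𝐁_k(Z)`), except that the bond-wise near-flatness of `U₀`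
is asked ONLY on a displayed finite window `W` of plaquettes (`hUwin`, `‖↑U₀_b − 1‖ ≤ δ` on the four bonds of each `p ∈ W`), while on the plaquettes off `W` having a bond that starts in
`Ω₁(Z) = maxDomT ν.M₁ Z 1` only PLAQUETTE smallness `‖↑U₀(∂p) − 1‖ ≤ ε` is asked (`hPfar` — gauge-invariant, the currency of [15] Thm 1 (8)); the Federbush fibre letter `hm` is read
against the window flat form `B_W(w′,w′) = ½·Σ_{p∈W}‖w′_{b₁}+w′_{b₂}−w′_{b₃}−w′_{b₄}‖²`; the direction `X_f′X` vanishes off `{b | b.src ∈ Ω₁(Z)}` by the support letter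
`B15Prop1RealChartFamilySupport.support_realChartFamily_atRecord` ((K′) + `hfar`, inside).  Conclusion: `γ₀·circ X − ((32(d−1)δ + 8(d−1)ε + μ + 16(d−1)ρδ₂(2+ρδ₂))·Kc² + τ)·‖X‖²
≤ ⟪X, D(∇ sliceFn (1.77) (ext Ṽ_k))(0) X⟫`.  Proof: dag-n12-w4's window skeleton + `haff` at the chart of record + the value identity along the slice + this lane's `h17` shape lemma.
[cite: Balaban1989LargeFieldII, p.357 («the quadratic form with the background field identically equal to 1»), (1.7)–(1.9) p.358, (1.12)–(1.13) p.359; Balaban1985BackgroundPropagators, (3.8) p.391, (3.10) p.392; Balaban1989LargeFieldI, (1.74) p.192, (1.77) and Prop. 1 p.194; Balaban1988Convergent, (2.2) p.255, (2.12)–(2.13) pp.256–257; Balaban1985Variational, Thm 1 (8) p.279, (47) p.285, (81) p.290, Prop. 9 (190) p.309] -/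
theorem h17Clause_of_nearFlatLetters_sub_window (ν : Node00.Stage7Numerics) (Kt : ℕ) {k : ℕ} (hk0 : 0 < k) (hk : k ≤ (F.P Kt).m + (F.P Kt).K)
    (Z Λ : Set (Site (F.P Kt) 0)) (T : Finset (PBond (F.P Kt) k))
    (ext : GaugeField (F.P Kt) k SU2 → GaugeField (F.P Kt) k SU2) (Vk : GaugeField (F.P Kt) k SU2)
    (hfar : ∀ b : PBond (F.P Kt) 0, b.src ∉ maxDomT ν.M₁ Z 1 → (⟨blockIter k b.src, b.dir⟩ : PBond (F.P Kt) k) ∉ bondsOf (pts k Λ))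
    (circ : GaugeSlice (pts k Λ) T E3 → ℝ) {γ₀ δ ε μ ρ δ₂ Kc τ : ℝ} (hδ0 : 0 ≤ δ) (hε0 : 0 ≤ ε) (hμ0 : 0 ≤ μ) (hρ0 : 0 ≤ ρ) (hδ₂0 : 0 ≤ δ₂)
    (U₀ : GaugeField (F.P Kt) 0 SU2) (W : Finset (Plaq (F.P Kt) 0))
    -- C1_window: bond-wise near-flatness on the window's plaquettes only
    (hUwin : ∀ p ∈ W, ‖((U₀ ⟨p.src, p.μ⟩ : SU2) : Matrix (Fin 2) (Fin 2) ℂ) - 1‖ ≤ δ ∧ ‖((U₀ ⟨p.src.shift p.μ, p.ν⟩ : SU2) : Matrix (Fin 2) (Fin 2) ℂ) - 1‖ ≤ δ ∧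
        ‖((U₀ ⟨p.src.shift p.ν, p.μ⟩ : SU2) : Matrix (Fin 2) (Fin 2) ℂ) - 1‖ ≤ δ ∧ ‖((U₀ ⟨p.src, p.ν⟩ : SU2) : Matrix (Fin 2) (Fin 2) ℂ) - 1‖ ≤ δ)
    -- P1: plaquette smallness off the window, on the plaquettes having a bond that starts in `Ω₁(Z)`
    (hPfar : ∀ p ∉ W, ((⟨p.src, p.μ⟩ : PBond (F.P Kt) 0) ∈ {b : PBond (F.P Kt) 0 | b.src ∈ maxDomT ν.M₁ Z 1} ∨
        (⟨p.src.shift p.μ, p.ν⟩ : PBond (F.P Kt) 0) ∈ {b : PBond (F.P Kt) 0 | b.src ∈ maxDomT ν.M₁ Z 1} ∨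
        (⟨p.src.shift p.ν, p.μ⟩ : PBond (F.P Kt) 0) ∈ {b : PBond (F.P Kt) 0 | b.src ∈ maxDomT ν.M₁ Z 1} ∨
        (⟨p.src, p.ν⟩ : PBond (F.P Kt) 0) ∈ {b : PBond (F.P Kt) 0 | b.src ∈ maxDomT ν.M₁ Z 1}) →
      ‖((GaugeField.plaqHol U₀ p : SU2) : Matrix (Fin 2) (Fin 2) ℂ) - 1‖ ≤ ε)
    (Xf : GaugeSlice (pts k Λ) T E3 → PBond (F.P Kt) 0 → lieSU (Fin 2)) (hX₀ : Xf 0 = 0) (hXc : ContDiffAt ℝ 2 Xf 0)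
    (hmin : ∀ᶠ Y in 𝓝 (0 : GaugeSlice (pts k Λ) T E3),
      IsMinimizer (Node00.avOfRecord F 2 Kt) (Node00.regMSCoPOfRecord F 2 ν Kt k (maxDomT ν.M₁ Z)) (Bj ν.M₁ Z k)
        (avgFamily (Node00.avOfRecord F 2 Kt) (qsstarGIter0 k (expMul su2Chart (ιA (pts k Λ) T Y) (ext Vk)))) (expChart U₀ (Xf Y)))
    {Ψ₂ : (PBond (F.P Kt) 0 → lieSU (Fin 2)) →L[ℝ] (PBond (F.P Kt) 0 → lieSU (Fin 2)) →L[ℝ] (Fin (constrCard (Bj ν.M₁ Z k) k) → lieSU (Fin 2))}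
    (hΨ₂ : HasFDerivAt (fun Y => fderiv ℝ (msChart F 2 Kt k (Bj ν.M₁ Z k) (avgFamily (Node00.avOfRecord F 2 Kt) (qsstarGIter0 k (ext Vk))) U₀) Y) Ψ₂ 0)
    (hΨd : ∀ᶠ Y in 𝓝 (0 : PBond (F.P Kt) 0 → lieSU (Fin 2)), DifferentiableAt ℝ (msChart F 2 Kt k (Bj ν.M₁ Z k) (avgFamily (Node00.avOfRecord F 2 Kt) (qsstarGIter0 k (ext Vk))) U₀) Y)
    {lam : (Fin (constrCard (Bj ν.M₁ Z k) k) → lieSU (Fin 2)) →L[ℝ] ℝ}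
    (hlam : fderiv ℝ (fun Y : PBond (F.P Kt) 0 → lieSU (Fin 2) => wilsonAction4 (expChart U₀ Y)) 0 =
      lam.comp (fderiv ℝ (msChart F 2 Kt k (Bj ν.M₁ Z k) (avgFamily (Node00.avOfRecord F 2 Kt) (qsstarGIter0 k (ext Vk))) U₀) 0))
    (p : Seminorm ℝ (PBond (F.P Kt) 0 → lieSU (Fin 2))) (hp : ∀ Y : PBond (F.P Kt) 0 → lieSU (Fin 2), ∑ b, ‖(Y b : Matrix (Fin 2) (Fin 2) ℂ)‖ ^ 2 ≤ p Y ^ 2)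
    (q : (Fin (constrCard (Bj ν.M₁ Z k) k) → lieSU (Fin 2)) → ℝ) (Lf : (PBond (F.P Kt) 0 → lieSU (Fin 2)) →L[ℝ] (Fin (constrCard (Bj ν.M₁ Z k) k) → lieSU (Fin 2)))
    {Rf : (Fin (constrCard (Bj ν.M₁ Z k) k) → lieSU (Fin 2)) → PBond (F.P Kt) 0 → lieSU (Fin 2)} (hRf : ∀ v, Lf (Rf v) = v) (hρ : ∀ v, p (Rf v) ≤ ρ * q v)
    -- per slice vector: (δ₂), (μ), (K) and the Federbush fibre letter AGAINST THE WINDOW FORM with `γ₀·circ − τ‖X‖² ≤ m`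
    (hX : ∀ X : GaugeSlice (pts k Λ) T E3,
      q (fderiv ℝ (msChart F 2 Kt k (Bj ν.M₁ Z k) (avgFamily (Node00.avOfRecord F 2 Kt) (qsstarGIter0 k (ext Vk))) U₀) 0 (fderiv ℝ Xf 0 X) - Lf (fderiv ℝ Xf 0 X))
          ≤ δ₂ * p (fderiv ℝ Xf 0 X) ∧
      lam (Ψ₂ (fderiv ℝ Xf 0 X) (fderiv ℝ Xf 0 X)) ≤ μ * p (fderiv ℝ Xf 0 X) ^ 2 ∧
      p (fderiv ℝ Xf 0 X) ≤ Kc * ‖X‖ ∧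
      ∃ m : ℝ, (∀ w', Lf w' = fderiv ℝ (msChart F 2 Kt k (Bj ν.M₁ Z k) (avgFamily (Node00.avOfRecord F 2 Kt) (qsstarGIter0 k (ext Vk))) U₀) 0 (fderiv ℝ Xf 0 X) →
          m ≤ ((Fintype.card (Fin 2) : ℝ)⁻¹ • ∑ p ∈ W, (innerSL ℝ (E := lieSU (Fin 2))).bilinearComp
            (ContinuousLinearMap.proj (R := ℝ) (φ := fun _ : PBond (F.P Kt) 0 => lieSU (Fin 2)) (⟨p.src, p.μ⟩ : PBond (F.P Kt) 0) + ContinuousLinearMap.proj (R := ℝ) (φ := fun _ : PBond (F.P Kt) 0 => lieSU (Fin 2)) (⟨p.src.shift p.μ, p.ν⟩ : PBond (F.P Kt) 0)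
              - ContinuousLinearMap.proj (R := ℝ) (φ := fun _ : PBond (F.P Kt) 0 => lieSU (Fin 2)) (⟨p.src.shift p.ν, p.μ⟩ : PBond (F.P Kt) 0) - ContinuousLinearMap.proj (R := ℝ) (φ := fun _ : PBond (F.P Kt) 0 => lieSU (Fin 2)) (⟨p.src, p.ν⟩ : PBond (F.P Kt) 0))
            (ContinuousLinearMap.proj (R := ℝ) (φ := fun _ : PBond (F.P Kt) 0 => lieSU (Fin 2)) (⟨p.src, p.μ⟩ : PBond (F.P Kt) 0) + ContinuousLinearMap.proj (R := ℝ) (φ := fun _ : PBond (F.P Kt) 0 => lieSU (Fin 2)) (⟨p.src.shift p.μ, p.ν⟩ : PBond (F.P Kt) 0)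
              - ContinuousLinearMap.proj (R := ℝ) (φ := fun _ : PBond (F.P Kt) 0 => lieSU (Fin 2)) (⟨p.src.shift p.ν, p.μ⟩ : PBond (F.P Kt) 0) - ContinuousLinearMap.proj (R := ℝ) (φ := fun _ : PBond (F.P Kt) 0 => lieSU (Fin 2)) (⟨p.src, p.ν⟩ : PBond (F.P Kt) 0))
            : (PBond (F.P Kt) 0 → lieSU (Fin 2)) →L[ℝ] (PBond (F.P Kt) 0 → lieSU (Fin 2)) →L[ℝ] ℝ) w' w') ∧
        γ₀ * circ X - τ * ‖X‖ ^ 2 ≤ m)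
    (X : GaugeSlice (pts k Λ) T E3) :
    γ₀ * circ X - ((32 * (((F.P Kt).d : ℝ) - 1) * δ + 8 * (((F.P Kt).d : ℝ) - 1) * ε + μ + 16 * (((F.P Kt).d : ℝ) - 1) * (ρ * δ₂) * (2 + ρ * δ₂)) * Kc ^ 2 + τ) * ‖X‖ ^ 2
      ≤ ⟪X, fderiv ℝ (rGrad (pts k Λ) T (sliceFn (pts k Λ) T (fun177std (Node00.bgMSCoPOfRecord F 2 ν Kt k (maxDomT ν.M₁ Z)) ν.M₁ Z k) (ext Vk))) 0 X⟫_ℝ := by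
  obtain ⟨hX1, hX2, hXd⟩ := triple_of_contDiffAt_two hXc
  obtain ⟨hδ₂, hμ, hK, m, hm, hcirc⟩ := hX X
  obtain ⟨φ, hφ⟩ := exists_lieSU2Coord
  have haff := haff_msChart_of_isMinimizer_family (pts k Λ) T hk hφ (Bj ν.M₁ Z k) (Node00.regMSCoPOfRecord F 2 ν Kt k (maxDomT ν.M₁ Z)) (ext Vk) U₀ hmin lam X X
  have hval := eventually_sliceFn_fun177std_bgMSCoPOfRecord_eq_wilsonAction4 ν Kt k (maxDomT ν.M₁ Z) ν.M₁ Z (pts k Λ) T (ext Vk) hmin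
  -- the support letter (r2): the family's velocity vanishes on the bonds starting outside `Ω₁(Z)`
  have hsupp : ∀ b ∉ {b : PBond (F.P Kt) 0 | b.src ∈ maxDomT ν.M₁ Z 1}, fderiv ℝ Xf 0 X b = 0 := fun b hb =>
    (B15Prop1RealChartFamilySupport.support_realChartFamily_atRecord ν Kt hk0 hk Z Λ T ext Vk hfar U₀ Xf hX₀ hXc.continuousAt hmin).2 X b hb
  have hd : 0 ≤ ((F.P Kt).d : ℝ) - 1 := by
    have h1 : (1 : ℝ) ≤ (F.P Kt).d := by exact_mod_cast (F.P Kt).hd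
    linarith
  have hC : 0 ≤ 32 * (((F.P Kt).d : ℝ) - 1) * δ + 8 * (((F.P Kt).d : ℝ) - 1) * ε + μ + 16 * (((F.P Kt).d : ℝ) - 1) * (ρ * δ₂) * (2 + ρ * δ₂) := by positivity
  have hlow := hessian_wilsonAction4_criticalExpChartFamily_ge_flatMin_sub_window (N := 2) U₀ W
    {b : PBond (F.P Kt) 0 | b.src ∈ maxDomT ν.M₁ Z 1} hδ0 hε0 hUwin hPfar (X := Xf) (g₀ := (0 : GaugeSlice (pts k Λ) T E3))
    hX₀ hX1 hX2 hXd hΨ₂ hΨd hlam X hsupp haff p hp q Lf hρ0 hRf hρ hδ₂ hμ hm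
  exact h17Shape_of_hessian_chartFamily_ge_sub (pts k Λ) T
    (fun177std (Node00.bgMSCoPOfRecord F 2 ν Kt k (maxDomT ν.M₁ Z)) ν.M₁ Z k) (ext Vk) U₀ hX1 hX2 hXd hval X p hC hlow hcirc hK

/-! ## §2  One instance, one base field: the WINDOW package gives (1.9) at the slice -/

/-- ★★ **(1.9) AT THE SLICE OF ONE BASE FIELD FROM THE NEAR-FLAT PACKAGE — WINDOW EDITION**: as `B15Prop1CoerciveAtNormalisedDatum.sliceCoercive_of_nearFlatLetters_sub_loc` (objects:
background `bgMSCoPOfRecord F 2 ν Kt k (maxDomT ν.M₁ Z)` at the class of record, determining set `𝐁_k(Z)`, slice over print's box `Λ^{(k)} = castSite '' [lo, hi]` with the `x₁`-axial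
tree `G₀`, extended base field `ext V_k`, the endpoint's curl sum as `circ`), with the window package of §1 (`W`, `hUwin`, `hPfar`, `hm` against `B_W`) in place of the bond-wise
letter on all of `Ω₁(Z)`'s plaquettes, and the numerics `hsm` for the window constant `(32(d−1)δ + 8(d−1)ε + μ + 16(d−1)ρδ₂(2+ρδ₂))·Kc² + τ ≤ γ₀∕(2(3K²+2K⁴))`, `hγle`:
`γ∕M⁵·‖X‖² ≤ ⟪X, D(∇ sliceFn … (ext V_k))(0) X⟫` for EVERY slice vector `X`.  Proof: §1 for every `X`, then the lane's (1.67) + (1.8) step `hessian_coercive_of_h17_ofDec`.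
[cite: Balaban1989LargeFieldII, p.357, (1.7)–(1.9) p.358, (1.12)–(1.13) p.359; Balaban1985BackgroundPropagators, (3.8) p.391, (3.10) p.392; Balaban1989LargeFieldI, (1.74) p.192, (1.77) and Prop. 1 p.194; Balaban1985Variational, (47) p.285, (81) p.290, Prop. 9 (190) p.309; Balaban1988Convergent, (2.2) p.255, (2.12)–(2.13) pp.256–257] -/
theorem sliceCoercive_of_nearFlatLetters_sub_window (ν : Node00.Stage7Numerics) (Kt : ℕ) (hd3 : 3 ≤ (F.P Kt).d) (h0 : 0 < (F.P Kt).d)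
    {k : ℕ} (hk0 : 0 < k) (hk : k ≤ (F.P Kt).m + (F.P Kt).K)
    (Z Λ : Set (Site (F.P Kt) 0)) (T : Finset (PBond (F.P Kt) k))
    {lo hi : Fin (F.P Kt).d → ℤ} (hbox : pts k Λ = (castSite '' Set.Icc lo hi : Set (Site (F.P Kt) k)))
    (hTG0 : T = (box (fun κ => (hi κ - lo κ + 1).toNat) lo).image fun x => (⟨castSite (x - unitVec ⟨0, h0⟩), ⟨0, h0⟩⟩ : PBond (F.P Kt) k))
    (hN5 : ∀ κ, ((hi κ - lo κ + 1).toNat : ℤ) + 5 < (F.P Kt).sitesPerDir k) {K : ℕ} (hK1 : 1 ≤ K) (hKn : ∀ κ, (hi κ - lo κ + 1).toNat ≤ K)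
    (ext : GaugeField (F.P Kt) k SU2 → GaugeField (F.P Kt) k SU2) (Vk : GaugeField (F.P Kt) k SU2)
    (hfar : ∀ b : PBond (F.P Kt) 0, b.src ∉ maxDomT ν.M₁ Z 1 → (⟨blockIter k b.src, b.dir⟩ : PBond (F.P Kt) k) ∉ bondsOf (pts k Λ))
    {γ M γ₀ δ ε μ ρ δ₂ Kc τ : ℝ} (hγ₀ : 0 ≤ γ₀) (hδ0 : 0 ≤ δ) (hε0 : 0 ≤ ε) (hμ0 : 0 ≤ μ) (hρ0 : 0 ≤ ρ) (hδ₂0 : 0 ≤ δ₂)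
    (U₀ : GaugeField (F.P Kt) 0 SU2) (W : Finset (Plaq (F.P Kt) 0))
    -- C1_window: bond-wise near-flatness on the window's plaquettes only
    (hUwin : ∀ p ∈ W, ‖((U₀ ⟨p.src, p.μ⟩ : SU2) : Matrix (Fin 2) (Fin 2) ℂ) - 1‖ ≤ δ ∧ ‖((U₀ ⟨p.src.shift p.μ, p.ν⟩ : SU2) : Matrix (Fin 2) (Fin 2) ℂ) - 1‖ ≤ δ ∧
        ‖((U₀ ⟨p.src.shift p.ν, p.μ⟩ : SU2) : Matrix (Fin 2) (Fin 2) ℂ) - 1‖ ≤ δ ∧ ‖((U₀ ⟨p.src, p.ν⟩ : SU2) : Matrix (Fin 2) (Fin 2) ℂ) - 1‖ ≤ δ)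
    -- P1: plaquette smallness off the window, on the plaquettes having a bond that starts in `Ω₁(Z)`
    (hPfar : ∀ p ∉ W, ((⟨p.src, p.μ⟩ : PBond (F.P Kt) 0) ∈ {b : PBond (F.P Kt) 0 | b.src ∈ maxDomT ν.M₁ Z 1} ∨
        (⟨p.src.shift p.μ, p.ν⟩ : PBond (F.P Kt) 0) ∈ {b : PBond (F.P Kt) 0 | b.src ∈ maxDomT ν.M₁ Z 1} ∨
        (⟨p.src.shift p.ν, p.μ⟩ : PBond (F.P Kt) 0) ∈ {b : PBond (F.P Kt) 0 | b.src ∈ maxDomT ν.M₁ Z 1} ∨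
        (⟨p.src, p.ν⟩ : PBond (F.P Kt) 0) ∈ {b : PBond (F.P Kt) 0 | b.src ∈ maxDomT ν.M₁ Z 1}) →
      ‖((GaugeField.plaqHol U₀ p : SU2) : Matrix (Fin 2) (Fin 2) ℂ) - 1‖ ≤ ε)
    (Xf : GaugeSlice (pts k Λ) T E3 → PBond (F.P Kt) 0 → lieSU (Fin 2)) (hX₀ : Xf 0 = 0) (hXc : ContDiffAt ℝ 2 Xf 0)
    (hmin : ∀ᶠ Y in 𝓝 (0 : GaugeSlice (pts k Λ) T E3),
      IsMinimizer (Node00.avOfRecord F 2 Kt) (Node00.regMSCoPOfRecord F 2 ν Kt k (maxDomT ν.M₁ Z)) (Bj ν.M₁ Z k)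
        (avgFamily (Node00.avOfRecord F 2 Kt) (qsstarGIter0 k (expMul su2Chart (ιA (pts k Λ) T Y) (ext Vk)))) (expChart U₀ (Xf Y)))
    {Ψ₂ : (PBond (F.P Kt) 0 → lieSU (Fin 2)) →L[ℝ] (PBond (F.P Kt) 0 → lieSU (Fin 2)) →L[ℝ] (Fin (constrCard (Bj ν.M₁ Z k) k) → lieSU (Fin 2))}
    (hΨ₂ : HasFDerivAt (fun Y => fderiv ℝ (msChart F 2 Kt k (Bj ν.M₁ Z k) (avgFamily (Node00.avOfRecord F 2 Kt) (qsstarGIter0 k (ext Vk))) U₀) Y) Ψ₂ 0)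
    (hΨd : ∀ᶠ Y in 𝓝 (0 : PBond (F.P Kt) 0 → lieSU (Fin 2)), DifferentiableAt ℝ (msChart F 2 Kt k (Bj ν.M₁ Z k) (avgFamily (Node00.avOfRecord F 2 Kt) (qsstarGIter0 k (ext Vk))) U₀) Y)
    {lam : (Fin (constrCard (Bj ν.M₁ Z k) k) → lieSU (Fin 2)) →L[ℝ] ℝ}
    (hlam : fderiv ℝ (fun Y : PBond (F.P Kt) 0 → lieSU (Fin 2) => wilsonAction4 (expChart U₀ Y)) 0 =
      lam.comp (fderiv ℝ (msChart F 2 Kt k (Bj ν.M₁ Z k) (avgFamily (Node00.avOfRecord F 2 Kt) (qsstarGIter0 k (ext Vk))) U₀) 0))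
    (p : Seminorm ℝ (PBond (F.P Kt) 0 → lieSU (Fin 2))) (hp : ∀ Y : PBond (F.P Kt) 0 → lieSU (Fin 2), ∑ b, ‖(Y b : Matrix (Fin 2) (Fin 2) ℂ)‖ ^ 2 ≤ p Y ^ 2)
    (q : (Fin (constrCard (Bj ν.M₁ Z k) k) → lieSU (Fin 2)) → ℝ) (Lf : (PBond (F.P Kt) 0 → lieSU (Fin 2)) →L[ℝ] (Fin (constrCard (Bj ν.M₁ Z k) k) → lieSU (Fin 2)))
    {Rf : (Fin (constrCard (Bj ν.M₁ Z k) k) → lieSU (Fin 2)) → PBond (F.P Kt) 0 → lieSU (Fin 2)} (hRf : ∀ v, Lf (Rf v) = v) (hρ : ∀ v, p (Rf v) ≤ ρ * q v)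
    -- per slice vector: (δ₂), (μ), (K) and the Federbush fibre letter AGAINST THE WINDOW FORM with `γ₀·circ − τ‖X‖² ≤ m`
    (hX : ∀ X : GaugeSlice (pts k Λ) T E3,
      q (fderiv ℝ (msChart F 2 Kt k (Bj ν.M₁ Z k) (avgFamily (Node00.avOfRecord F 2 Kt) (qsstarGIter0 k (ext Vk))) U₀) 0 (fderiv ℝ Xf 0 X) - Lf (fderiv ℝ Xf 0 X))
          ≤ δ₂ * p (fderiv ℝ Xf 0 X) ∧
      lam (Ψ₂ (fderiv ℝ Xf 0 X) (fderiv ℝ Xf 0 X)) ≤ μ * p (fderiv ℝ Xf 0 X) ^ 2 ∧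
      p (fderiv ℝ Xf 0 X) ≤ Kc * ‖X‖ ∧
      ∃ m : ℝ, (∀ w', Lf w' = fderiv ℝ (msChart F 2 Kt k (Bj ν.M₁ Z k) (avgFamily (Node00.avOfRecord F 2 Kt) (qsstarGIter0 k (ext Vk))) U₀) 0 (fderiv ℝ Xf 0 X) →
          m ≤ ((Fintype.card (Fin 2) : ℝ)⁻¹ • ∑ p ∈ W, (innerSL ℝ (E := lieSU (Fin 2))).bilinearComp
            (ContinuousLinearMap.proj (R := ℝ) (φ := fun _ : PBond (F.P Kt) 0 => lieSU (Fin 2)) (⟨p.src, p.μ⟩ : PBond (F.P Kt) 0) + ContinuousLinearMap.proj (R := ℝ) (φ := fun _ : PBond (F.P Kt) 0 => lieSU (Fin 2)) (⟨p.src.shift p.μ, p.ν⟩ : PBond (F.P Kt) 0)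
              - ContinuousLinearMap.proj (R := ℝ) (φ := fun _ : PBond (F.P Kt) 0 => lieSU (Fin 2)) (⟨p.src.shift p.ν, p.μ⟩ : PBond (F.P Kt) 0) - ContinuousLinearMap.proj (R := ℝ) (φ := fun _ : PBond (F.P Kt) 0 => lieSU (Fin 2)) (⟨p.src, p.ν⟩ : PBond (F.P Kt) 0))
            (ContinuousLinearMap.proj (R := ℝ) (φ := fun _ : PBond (F.P Kt) 0 => lieSU (Fin 2)) (⟨p.src, p.μ⟩ : PBond (F.P Kt) 0) + ContinuousLinearMap.proj (R := ℝ) (φ := fun _ : PBond (F.P Kt) 0 => lieSU (Fin 2)) (⟨p.src.shift p.μ, p.ν⟩ : PBond (F.P Kt) 0)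
              - ContinuousLinearMap.proj (R := ℝ) (φ := fun _ : PBond (F.P Kt) 0 => lieSU (Fin 2)) (⟨p.src.shift p.ν, p.μ⟩ : PBond (F.P Kt) 0) - ContinuousLinearMap.proj (R := ℝ) (φ := fun _ : PBond (F.P Kt) 0 => lieSU (Fin 2)) (⟨p.src, p.ν⟩ : PBond (F.P Kt) 0))
            : (PBond (F.P Kt) 0 → lieSU (Fin 2)) →L[ℝ] (PBond (F.P Kt) 0 → lieSU (Fin 2)) →L[ℝ] ℝ) w' w') ∧
        γ₀ * (∑ z ∈ box (fun κ => (hi κ - lo κ + 1).toNat + 3) (fun κ => lo κ - 2), ∑ μ : Fin (F.P Kt).d, ∑ a : Fin 3,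
            curl (fun b => ιA (pts k Λ) T X (⟨castSite b.1, b.2⟩ : PBond (F.P Kt) k) a) z ⟨0, h0⟩ μ ^ 2) - τ * ‖X‖ ^ 2 ≤ m)
    -- numerics: the assembled WINDOW `Cerr` (with the plaquette-smallness term `8(d−1)ε` and the twist defect `τ`) is small, and the positivity constant fits
    (hsm : (32 * (((F.P Kt).d : ℝ) - 1) * δ + 8 * (((F.P Kt).d : ℝ) - 1) * ε + μ + 16 * (((F.P Kt).d : ℝ) - 1) * (ρ * δ₂) * (2 + ρ * δ₂)) * Kc ^ 2 + τ
      ≤ γ₀ / (2 * (3 * (K : ℝ) ^ 2 + 2 * (K : ℝ) ^ 4)))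
    (hγle : γ / M ^ 5 ≤ γ₀ / (2 * (3 * (K : ℝ) ^ 2 + 2 * (K : ℝ) ^ 4)))
    (X : GaugeSlice (pts k Λ) T E3) :
    γ / M ^ 5 * ‖X‖ ^ 2
      ≤ ⟪X, fderiv ℝ (rGrad (pts k Λ) T (sliceFn (pts k Λ) T (fun177std (Node00.bgMSCoPOfRecord F 2 ν Kt k (maxDomT ν.M₁ Z)) ν.M₁ Z k) (ext Vk))) 0 X⟫_ℝ :=
  hessian_coercive_of_h17_ofDec (hdec := inferInstance) (Subsingleton.elim _ _) hd3 h0 hbox hTG0 hN5 hK1 hKn hγ₀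
    (sliceFn (pts k Λ) T (fun177std (Node00.bgMSCoPOfRecord F 2 ν Kt k (maxDomT ν.M₁ Z)) ν.M₁ Z k) (ext Vk))
    (fun X => h17Clause_of_nearFlatLetters_sub_window ν Kt hk0 hk Z Λ T ext Vk hfar
      (fun X => ∑ z ∈ box (fun κ => (hi κ - lo κ + 1).toNat + 3) (fun κ => lo κ - 2), ∑ μ : Fin (F.P Kt).d, ∑ a : Fin 3,
        curl (fun b => ιA (pts k Λ) T X (⟨castSite b.1, b.2⟩ : PBond (F.P Kt) k) a) z ⟨0, h0⟩ μ ^ 2)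
      hδ0 hε0 hμ0 hρ0 hδ₂0 U₀ W hUwin hPfar Xf hX₀ hXc hmin hΨ₂ hΨd hlam p hp q Lf hRf hρ hX X)
    hsm hγle X

end Window

/-! ## §3  The DIRECT editions: the Federbush letter asked at the family's velocity itself — no flat linearisation `L♭`, no right inverse `R♭`, no (δ₂), no `ρ`, no `q` -/

section Direct

variable {P : Params} {j : ℕ} {N : ℕ} [NeZero N]

/-- ★★ **THE WILSON-SIDE SKELETON, WINDOW + DIRECT EDITION** (generic torus ∕ level ∕ `N`): dag-n12-w4's `hessian_wilsonAction4_criticalExpChartFamily_ge_flatMin_sub_window` asks the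
fibre letter `hm : ∀ w′, L♭ w′ = DΨ(0)(X′h) → m ≤ B_W(w′,w′)` on the fibre of a displayed FLAT linearisation `L♭` with a right inverse `R♭` (`p∘R♭ ≤ ρ·q`) and the comparison row
(δ₂) `q(DΨ(0)(X′h) − L♭(X′h)) ≤ δ₂·p(X′h)`; the skeleton then moves `X′h` into that fibre at cost `16(d−1)ρδ₂(2+ρδ₂)·p(X′h)²`.  If the Federbush letter is asked AT THE VELOCITY
ITSELF — `hm : m ≤ B_W(X′h, X′h)` — none of `L♭`, `R♭`, `q`, `ρ`, `δ₂` is needed: dag-n12-w3's value-Hessian identity `D²(A∘expChart U₀∘X)(h,h) = D²(A∘expChart U₀)(0)(X′h,X′h)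
− λ(Ψ₂(X′h,X′h)) + λ(D²(Ψ∘X)(h,h))` (`B11Eq177CriticalFamilyDerivative.hessian_value_criticalFamily`), the affine-datum letter `haff`, the multiplier row (μ) and dag-n12-w4's window letter
(δ₁)_W give at once `m − (32(d−1)δ + 8(d−1)ε + μ)·p(X′h)² ≤ D²(A∘expChart U₀∘X)(g₀)(h,h)`.  (The consumer's `hm` is then a statement about the k-fold linearised averages of the ONE
field `X′h` on the window — where they REPRODUCE the curved datum velocity by the family's defining property — and needs the background only on the window.)
[cite: Balaban1989LargeFieldII, p.357, (1.7) p.358, (1.12) p.359; Balaban1985BackgroundPropagators, (3.8) p.391, (3.10) p.392; Balaban1985Variational, (81)–(83) p.290, (172)–(177) pp.305–306] -/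
theorem hessian_wilsonAction4_criticalExpChartFamily_ge_direct_sub_window
    {V G : Type*} [NormedAddCommGroup V] [NormedSpace ℝ V] [NormedAddCommGroup G] [NormedSpace ℝ G]
    (U₀ : GaugeField P j (SU N)) (W : Finset (Plaq P j)) (B₀ : Set (PBond P j)) {δ ε : ℝ} (hδ0 : 0 ≤ δ) (hε0 : 0 ≤ ε)
    (hU : ∀ p ∈ W, ‖(U₀ ⟨p.src, p.μ⟩ : Matrix (Fin N) (Fin N) ℂ) - 1‖ ≤ δ ∧ ‖(U₀ ⟨p.src.shift p.μ, p.ν⟩ : Matrix (Fin N) (Fin N) ℂ) - 1‖ ≤ δ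
        ∧ ‖(U₀ ⟨p.src.shift p.ν, p.μ⟩ : Matrix (Fin N) (Fin N) ℂ) - 1‖ ≤ δ ∧ ‖(U₀ ⟨p.src, p.ν⟩ : Matrix (Fin N) (Fin N) ℂ) - 1‖ ≤ δ)
    (hP : ∀ p ∉ W, ((⟨p.src, p.μ⟩ : PBond P j) ∈ B₀ ∨ (⟨p.src.shift p.μ, p.ν⟩ : PBond P j) ∈ B₀ ∨ (⟨p.src.shift p.ν, p.μ⟩ : PBond P j) ∈ B₀ ∨ (⟨p.src, p.ν⟩ : PBond P j) ∈ B₀) →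
      ‖((GaugeField.plaqHol U₀ p : SU N) : Matrix (Fin N) (Fin N) ℂ) - 1‖ ≤ ε)
    {Ψ : (PBond P j → lieSU (Fin N)) → V} {X : G → PBond P j → lieSU (Fin N)} {g₀ : G}
    (hX₀ : X g₀ = 0) {X' : G →L[ℝ] PBond P j → lieSU (Fin N)} (hX : HasFDerivAt X X' g₀)
    {X₂ : G →L[ℝ] G →L[ℝ] PBond P j → lieSU (Fin N)} (hX₂ : HasFDerivAt (fun g => fderiv ℝ X g) X₂ g₀)
    (hXd : ∀ᶠ g in 𝓝 g₀, DifferentiableAt ℝ X g)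
    {Ψ₂ : (PBond P j → lieSU (Fin N)) →L[ℝ] (PBond P j → lieSU (Fin N)) →L[ℝ] V} (hΨ₂ : HasFDerivAt (fun Y => fderiv ℝ Ψ Y) Ψ₂ 0)
    (hΨd : ∀ᶠ Y in 𝓝 (0 : PBond P j → lieSU (Fin N)), DifferentiableAt ℝ Ψ Y)
    {lam : V →L[ℝ] ℝ} (hlam : fderiv ℝ (fun Y : PBond P j → lieSU (Fin N) => wilsonAction4 (expChart U₀ Y)) 0 = lam.comp (fderiv ℝ Ψ 0)) (h : G)
    (hsupp : ∀ b ∉ B₀, X' h b = 0)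
    (haff : lam (fderiv ℝ (fun g => fderiv ℝ (fun g => Ψ (X g)) g) g₀ h h) = 0)
    (p : Seminorm ℝ (PBond P j → lieSU (Fin N))) (hp : ∀ Y : PBond P j → lieSU (Fin N), ∑ b, ‖(Y b : Matrix (Fin N) (Fin N) ℂ)‖ ^ 2 ≤ p Y ^ 2)
    {μ : ℝ} (hμ : lam (Ψ₂ (X' h) (X' h)) ≤ μ * p (X' h) ^ 2)
    {m : ℝ} (hm : m ≤ ((Fintype.card (Fin N) : ℝ)⁻¹ • ∑ p ∈ W, (innerSL ℝ (E := lieSU (Fin N))).bilinearComp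
        (ContinuousLinearMap.proj (R := ℝ) (φ := fun _ : PBond P j => lieSU (Fin N)) (⟨p.src, p.μ⟩ : PBond P j) + ContinuousLinearMap.proj (R := ℝ) (φ := fun _ : PBond P j => lieSU (Fin N)) (⟨p.src.shift p.μ, p.ν⟩ : PBond P j)
          - ContinuousLinearMap.proj (R := ℝ) (φ := fun _ : PBond P j => lieSU (Fin N)) (⟨p.src.shift p.ν, p.μ⟩ : PBond P j) - ContinuousLinearMap.proj (R := ℝ) (φ := fun _ : PBond P j => lieSU (Fin N)) (⟨p.src, p.ν⟩ : PBond P j))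
        (ContinuousLinearMap.proj (R := ℝ) (φ := fun _ : PBond P j => lieSU (Fin N)) (⟨p.src, p.μ⟩ : PBond P j) + ContinuousLinearMap.proj (R := ℝ) (φ := fun _ : PBond P j => lieSU (Fin N)) (⟨p.src.shift p.μ, p.ν⟩ : PBond P j)
          - ContinuousLinearMap.proj (R := ℝ) (φ := fun _ : PBond P j => lieSU (Fin N)) (⟨p.src.shift p.ν, p.μ⟩ : PBond P j) - ContinuousLinearMap.proj (R := ℝ) (φ := fun _ : PBond P j => lieSU (Fin N)) (⟨p.src, p.ν⟩ : PBond P j))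
        : (PBond P j → lieSU (Fin N)) →L[ℝ] (PBond P j → lieSU (Fin N)) →L[ℝ] ℝ) (X' h) (X' h)) :
    m - (32 * ((P.d : ℝ) - 1) * δ + 8 * ((P.d : ℝ) - 1) * ε + μ) * p (X' h) ^ 2
      ≤ fderiv ℝ (fun g => fderiv ℝ (fun g => wilsonAction4 (expChart U₀ (X g))) g) g₀ h h := by
  have hid := B11Eq177CriticalFamilyDerivative.hessian_value_criticalFamily hX₀ hX hX₂ hXd
    (B11Eq177CriticalFamilyDerivative.hasFDerivAt_fderiv_wilsonAction4_expChart U₀ 0)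
    (Filter.Eventually.of_forall fun Y => ((B11Eq177CriticalFamilyDerivative.contDiff_wilsonAction4_expChart U₀).differentiable (by simp)).differentiableAt)
    hΨ₂ hΨd hlam h h
  have hδ₁ := B16Ineq17NearFlatWilsonLettersWindow.letter_delta1_wilson_window U₀ W B₀ hδ0 hε0 hU hP p hp (X' h) hsupp
  have key : m - (32 * ((P.d : ℝ) - 1) * δ + 8 * ((P.d : ℝ) - 1) * ε + μ) * p (X' h) ^ 2
      ≤ fderiv ℝ (fun Y => fderiv ℝ (fun Y : PBond P j → lieSU (Fin N) => wilsonAction4 (expChart U₀ Y)) Y) 0 (X' h) (X' h) - lam (Ψ₂ (X' h) (X' h)) := by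
    linarith [hδ₁, hμ, hm]
  rw [hid, haff, add_zero]
  exact key

end Direct

section DirectRecord

variable {F : T4Family}

/-- ★★ **THE `h17` CLAUSE — WINDOW + DIRECT EDITION**: as §1's `h17Clause_of_nearFlatLetters_sub_window` but with the per-vector chart letters REDUCED to (μ), (K) and the Federbush
letter AT THE VELOCITY `γ₀·circ X − τ·‖X‖² ≤ B_W(X_f′X, X_f′X)`; the binders `q`, `L♭`, `R♭`, `hRf`, `hρ`, `ρ`, `δ₂` and the row (δ₂) are GONE, and the constant is
`(32(d−1)δ + 8(d−1)ε + μ)·Kc² + τ`.  Proof: §3's direct skeleton in place of the fibre-transfer one; everything else verbatim.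
[cite: Balaban1989LargeFieldII, p.357, (1.7)–(1.9) p.358, (1.12)–(1.13) p.359; Balaban1985BackgroundPropagators, (3.8) p.391, (3.10) p.392; Balaban1989LargeFieldI, (1.74) p.192, (1.77) and Prop. 1 p.194; Balaban1988Convergent, (2.2) p.255, (2.12)–(2.13) pp.256–257; Balaban1985Variational, Thm 1 (8) p.279, (47) p.285, (81) p.290, Prop. 9 (190) p.309] -/
theorem h17Clause_of_windowLetters_direct (ν : Node00.Stage7Numerics) (Kt : ℕ) {k : ℕ} (hk0 : 0 < k) (hk : k ≤ (F.P Kt).m + (F.P Kt).K)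
    (Z Λ : Set (Site (F.P Kt) 0)) (T : Finset (PBond (F.P Kt) k))
    (ext : GaugeField (F.P Kt) k SU2 → GaugeField (F.P Kt) k SU2) (Vk : GaugeField (F.P Kt) k SU2)
    (hfar : ∀ b : PBond (F.P Kt) 0, b.src ∉ maxDomT ν.M₁ Z 1 → (⟨blockIter k b.src, b.dir⟩ : PBond (F.P Kt) k) ∉ bondsOf (pts k Λ))
    (circ : GaugeSlice (pts k Λ) T E3 → ℝ) {γ₀ δ ε μ Kc τ : ℝ} (hδ0 : 0 ≤ δ) (hε0 : 0 ≤ ε) (hμ0 : 0 ≤ μ)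
    (U₀ : GaugeField (F.P Kt) 0 SU2) (W : Finset (Plaq (F.P Kt) 0))
    (hUwin : ∀ p ∈ W, ‖((U₀ ⟨p.src, p.μ⟩ : SU2) : Matrix (Fin 2) (Fin 2) ℂ) - 1‖ ≤ δ ∧ ‖((U₀ ⟨p.src.shift p.μ, p.ν⟩ : SU2) : Matrix (Fin 2) (Fin 2) ℂ) - 1‖ ≤ δ ∧
        ‖((U₀ ⟨p.src.shift p.ν, p.μ⟩ : SU2) : Matrix (Fin 2) (Fin 2) ℂ) - 1‖ ≤ δ ∧ ‖((U₀ ⟨p.src, p.ν⟩ : SU2) : Matrix (Fin 2) (Fin 2) ℂ) - 1‖ ≤ δ)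
    (hPfar : ∀ p ∉ W, ((⟨p.src, p.μ⟩ : PBond (F.P Kt) 0) ∈ {b : PBond (F.P Kt) 0 | b.src ∈ maxDomT ν.M₁ Z 1} ∨
        (⟨p.src.shift p.μ, p.ν⟩ : PBond (F.P Kt) 0) ∈ {b : PBond (F.P Kt) 0 | b.src ∈ maxDomT ν.M₁ Z 1} ∨
        (⟨p.src.shift p.ν, p.μ⟩ : PBond (F.P Kt) 0) ∈ {b : PBond (F.P Kt) 0 | b.src ∈ maxDomT ν.M₁ Z 1} ∨
        (⟨p.src, p.ν⟩ : PBond (F.P Kt) 0) ∈ {b : PBond (F.P Kt) 0 | b.src ∈ maxDomT ν.M₁ Z 1}) →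
      ‖((GaugeField.plaqHol U₀ p : SU2) : Matrix (Fin 2) (Fin 2) ℂ) - 1‖ ≤ ε)
    (Xf : GaugeSlice (pts k Λ) T E3 → PBond (F.P Kt) 0 → lieSU (Fin 2)) (hX₀ : Xf 0 = 0) (hXc : ContDiffAt ℝ 2 Xf 0)
    (hmin : ∀ᶠ Y in 𝓝 (0 : GaugeSlice (pts k Λ) T E3),
      IsMinimizer (Node00.avOfRecord F 2 Kt) (Node00.regMSCoPOfRecord F 2 ν Kt k (maxDomT ν.M₁ Z)) (Bj ν.M₁ Z k)
        (avgFamily (Node00.avOfRecord F 2 Kt) (qsstarGIter0 k (expMul su2Chart (ιA (pts k Λ) T Y) (ext Vk)))) (expChart U₀ (Xf Y)))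
    {Ψ₂ : (PBond (F.P Kt) 0 → lieSU (Fin 2)) →L[ℝ] (PBond (F.P Kt) 0 → lieSU (Fin 2)) →L[ℝ] (Fin (constrCard (Bj ν.M₁ Z k) k) → lieSU (Fin 2))}
    (hΨ₂ : HasFDerivAt (fun Y => fderiv ℝ (msChart F 2 Kt k (Bj ν.M₁ Z k) (avgFamily (Node00.avOfRecord F 2 Kt) (qsstarGIter0 k (ext Vk))) U₀) Y) Ψ₂ 0)
    (hΨd : ∀ᶠ Y in 𝓝 (0 : PBond (F.P Kt) 0 → lieSU (Fin 2)), DifferentiableAt ℝ (msChart F 2 Kt k (Bj ν.M₁ Z k) (avgFamily (Node00.avOfRecord F 2 Kt) (qsstarGIter0 k (ext Vk))) U₀) Y)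
    {lam : (Fin (constrCard (Bj ν.M₁ Z k) k) → lieSU (Fin 2)) →L[ℝ] ℝ}
    (hlam : fderiv ℝ (fun Y : PBond (F.P Kt) 0 → lieSU (Fin 2) => wilsonAction4 (expChart U₀ Y)) 0 =
      lam.comp (fderiv ℝ (msChart F 2 Kt k (Bj ν.M₁ Z k) (avgFamily (Node00.avOfRecord F 2 Kt) (qsstarGIter0 k (ext Vk))) U₀) 0))
    (p : Seminorm ℝ (PBond (F.P Kt) 0 → lieSU (Fin 2))) (hp : ∀ Y : PBond (F.P Kt) 0 → lieSU (Fin 2), ∑ b, ‖(Y b : Matrix (Fin 2) (Fin 2) ℂ)‖ ^ 2 ≤ p Y ^ 2)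
    -- per slice vector: (μ), (K) and the Federbush letter AT THE VELOCITY against the window form
    (hX : ∀ X : GaugeSlice (pts k Λ) T E3,
      lam (Ψ₂ (fderiv ℝ Xf 0 X) (fderiv ℝ Xf 0 X)) ≤ μ * p (fderiv ℝ Xf 0 X) ^ 2 ∧
      p (fderiv ℝ Xf 0 X) ≤ Kc * ‖X‖ ∧
      γ₀ * circ X - τ * ‖X‖ ^ 2 ≤ ((Fintype.card (Fin 2) : ℝ)⁻¹ • ∑ p ∈ W, (innerSL ℝ (E := lieSU (Fin 2))).bilinearComp
            (ContinuousLinearMap.proj (R := ℝ) (φ := fun _ : PBond (F.P Kt) 0 => lieSU (Fin 2)) (⟨p.src, p.μ⟩ : PBond (F.P Kt) 0) + ContinuousLinearMap.proj (R := ℝ) (φ := fun _ : PBond (F.P Kt) 0 => lieSU (Fin 2)) (⟨p.src.shift p.μ, p.ν⟩ : PBond (F.P Kt) 0)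
              - ContinuousLinearMap.proj (R := ℝ) (φ := fun _ : PBond (F.P Kt) 0 => lieSU (Fin 2)) (⟨p.src.shift p.ν, p.μ⟩ : PBond (F.P Kt) 0) - ContinuousLinearMap.proj (R := ℝ) (φ := fun _ : PBond (F.P Kt) 0 => lieSU (Fin 2)) (⟨p.src, p.ν⟩ : PBond (F.P Kt) 0))
            (ContinuousLinearMap.proj (R := ℝ) (φ := fun _ : PBond (F.P Kt) 0 => lieSU (Fin 2)) (⟨p.src, p.μ⟩ : PBond (F.P Kt) 0) + ContinuousLinearMap.proj (R := ℝ) (φ := fun _ : PBond (F.P Kt) 0 => lieSU (Fin 2)) (⟨p.src.shift p.μ, p.ν⟩ : PBond (F.P Kt) 0)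
              - ContinuousLinearMap.proj (R := ℝ) (φ := fun _ : PBond (F.P Kt) 0 => lieSU (Fin 2)) (⟨p.src.shift p.ν, p.μ⟩ : PBond (F.P Kt) 0) - ContinuousLinearMap.proj (R := ℝ) (φ := fun _ : PBond (F.P Kt) 0 => lieSU (Fin 2)) (⟨p.src, p.ν⟩ : PBond (F.P Kt) 0))
            : (PBond (F.P Kt) 0 → lieSU (Fin 2)) →L[ℝ] (PBond (F.P Kt) 0 → lieSU (Fin 2)) →L[ℝ] ℝ) (fderiv ℝ Xf 0 X) (fderiv ℝ Xf 0 X))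
    (X : GaugeSlice (pts k Λ) T E3) :
    γ₀ * circ X - ((32 * (((F.P Kt).d : ℝ) - 1) * δ + 8 * (((F.P Kt).d : ℝ) - 1) * ε + μ) * Kc ^ 2 + τ) * ‖X‖ ^ 2
      ≤ ⟪X, fderiv ℝ (rGrad (pts k Λ) T (sliceFn (pts k Λ) T (fun177std (Node00.bgMSCoPOfRecord F 2 ν Kt k (maxDomT ν.M₁ Z)) ν.M₁ Z k) (ext Vk))) 0 X⟫_ℝ := by
  obtain ⟨hX1, hX2, hXd⟩ := triple_of_contDiffAt_two hXc
  obtain ⟨hμ, hK, hmX⟩ := hX X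
  obtain ⟨φ, hφ⟩ := exists_lieSU2Coord
  have haff := haff_msChart_of_isMinimizer_family (pts k Λ) T hk hφ (Bj ν.M₁ Z k) (Node00.regMSCoPOfRecord F 2 ν Kt k (maxDomT ν.M₁ Z)) (ext Vk) U₀ hmin lam X X
  have hval := eventually_sliceFn_fun177std_bgMSCoPOfRecord_eq_wilsonAction4 ν Kt k (maxDomT ν.M₁ Z) ν.M₁ Z (pts k Λ) T (ext Vk) hmin
  have hsupp : ∀ b ∉ {b : PBond (F.P Kt) 0 | b.src ∈ maxDomT ν.M₁ Z 1}, fderiv ℝ Xf 0 X b = 0 := fun b hb =>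
    (B15Prop1RealChartFamilySupport.support_realChartFamily_atRecord ν Kt hk0 hk Z Λ T ext Vk hfar U₀ Xf hX₀ hXc.continuousAt hmin).2 X b hb
  have hd : 0 ≤ ((F.P Kt).d : ℝ) - 1 := by
    have h1 : (1 : ℝ) ≤ (F.P Kt).d := by exact_mod_cast (F.P Kt).hd
    linarith
  have hC : 0 ≤ 32 * (((F.P Kt).d : ℝ) - 1) * δ + 8 * (((F.P Kt).d : ℝ) - 1) * ε + μ := by positivity
  have hlow := hessian_wilsonAction4_criticalExpChartFamily_ge_direct_sub_window (N := 2) U₀ W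
    {b : PBond (F.P Kt) 0 | b.src ∈ maxDomT ν.M₁ Z 1} hδ0 hε0 hUwin hPfar (X := Xf) (g₀ := (0 : GaugeSlice (pts k Λ) T E3))
    hX₀ hX1 hX2 hXd hΨ₂ hΨd hlam X hsupp haff p hp hμ (le_refl _)
  exact h17Shape_of_hessian_chartFamily_ge_sub (pts k Λ) T
    (fun177std (Node00.bgMSCoPOfRecord F 2 ν Kt k (maxDomT ν.M₁ Z)) ν.M₁ Z k) (ext Vk) U₀ hX1 hX2 hXd hval X p hC hlow hmX hK

/-- ★★ **(1.9) AT THE SLICE — WINDOW + DIRECT EDITION**: as §2's `sliceCoercive_of_nearFlatLetters_sub_window` with the per-vector letters reduced to (μ), (K) and the Federbush letter at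
the velocity (the endpoint's curl sum as `circ`), numerics `hsm : (32(d−1)δ + 8(d−1)ε + μ)·Kc² + τ ≤ γ₀∕(2(3K²+2K⁴))`, `hγle`.
[cite: Balaban1989LargeFieldII, p.357, (1.7)–(1.9) p.358, (1.12)–(1.13) p.359; Balaban1985BackgroundPropagators, (3.8) p.391, (3.10) p.392; Balaban1989LargeFieldI, (1.74) p.192, (1.77) and Prop. 1 p.194; Balaban1985Variational, (47) p.285, (81) p.290, Prop. 9 (190) p.309; Balaban1988Convergent, (2.2) p.255, (2.12)–(2.13) pp.256–257] -/
theorem sliceCoercive_of_windowLetters_direct (ν : Node00.Stage7Numerics) (Kt : ℕ) (hd3 : 3 ≤ (F.P Kt).d) (h0 : 0 < (F.P Kt).d)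
    {k : ℕ} (hk0 : 0 < k) (hk : k ≤ (F.P Kt).m + (F.P Kt).K)
    (Z Λ : Set (Site (F.P Kt) 0)) (T : Finset (PBond (F.P Kt) k))
    {lo hi : Fin (F.P Kt).d → ℤ} (hbox : pts k Λ = (castSite '' Set.Icc lo hi : Set (Site (F.P Kt) k)))
    (hTG0 : T = (box (fun κ => (hi κ - lo κ + 1).toNat) lo).image fun x => (⟨castSite (x - unitVec ⟨0, h0⟩), ⟨0, h0⟩⟩ : PBond (F.P Kt) k))
    (hN5 : ∀ κ, ((hi κ - lo κ + 1).toNat : ℤ) + 5 < (F.P Kt).sitesPerDir k) {K : ℕ} (hK1 : 1 ≤ K) (hKn : ∀ κ, (hi κ - lo κ + 1).toNat ≤ K)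
    (ext : GaugeField (F.P Kt) k SU2 → GaugeField (F.P Kt) k SU2) (Vk : GaugeField (F.P Kt) k SU2)
    (hfar : ∀ b : PBond (F.P Kt) 0, b.src ∉ maxDomT ν.M₁ Z 1 → (⟨blockIter k b.src, b.dir⟩ : PBond (F.P Kt) k) ∉ bondsOf (pts k Λ))
    {γ M γ₀ δ ε μ Kc τ : ℝ} (hγ₀ : 0 ≤ γ₀) (hδ0 : 0 ≤ δ) (hε0 : 0 ≤ ε) (hμ0 : 0 ≤ μ)
    (U₀ : GaugeField (F.P Kt) 0 SU2) (W : Finset (Plaq (F.P Kt) 0))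
    (hUwin : ∀ p ∈ W, ‖((U₀ ⟨p.src, p.μ⟩ : SU2) : Matrix (Fin 2) (Fin 2) ℂ) - 1‖ ≤ δ ∧ ‖((U₀ ⟨p.src.shift p.μ, p.ν⟩ : SU2) : Matrix (Fin 2) (Fin 2) ℂ) - 1‖ ≤ δ ∧
        ‖((U₀ ⟨p.src.shift p.ν, p.μ⟩ : SU2) : Matrix (Fin 2) (Fin 2) ℂ) - 1‖ ≤ δ ∧ ‖((U₀ ⟨p.src, p.ν⟩ : SU2) : Matrix (Fin 2) (Fin 2) ℂ) - 1‖ ≤ δ)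
    (hPfar : ∀ p ∉ W, ((⟨p.src, p.μ⟩ : PBond (F.P Kt) 0) ∈ {b : PBond (F.P Kt) 0 | b.src ∈ maxDomT ν.M₁ Z 1} ∨
        (⟨p.src.shift p.μ, p.ν⟩ : PBond (F.P Kt) 0) ∈ {b : PBond (F.P Kt) 0 | b.src ∈ maxDomT ν.M₁ Z 1} ∨
        (⟨p.src.shift p.ν, p.μ⟩ : PBond (F.P Kt) 0) ∈ {b : PBond (F.P Kt) 0 | b.src ∈ maxDomT ν.M₁ Z 1} ∨
        (⟨p.src, p.ν⟩ : PBond (F.P Kt) 0) ∈ {b : PBond (F.P Kt) 0 | b.src ∈ maxDomT ν.M₁ Z 1}) →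
      ‖((GaugeField.plaqHol U₀ p : SU2) : Matrix (Fin 2) (Fin 2) ℂ) - 1‖ ≤ ε)
    (Xf : GaugeSlice (pts k Λ) T E3 → PBond (F.P Kt) 0 → lieSU (Fin 2)) (hX₀ : Xf 0 = 0) (hXc : ContDiffAt ℝ 2 Xf 0)
    (hmin : ∀ᶠ Y in 𝓝 (0 : GaugeSlice (pts k Λ) T E3),
      IsMinimizer (Node00.avOfRecord F 2 Kt) (Node00.regMSCoPOfRecord F 2 ν Kt k (maxDomT ν.M₁ Z)) (Bj ν.M₁ Z k)
        (avgFamily (Node00.avOfRecord F 2 Kt) (qsstarGIter0 k (expMul su2Chart (ιA (pts k Λ) T Y) (ext Vk)))) (expChart U₀ (Xf Y)))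
    {Ψ₂ : (PBond (F.P Kt) 0 → lieSU (Fin 2)) →L[ℝ] (PBond (F.P Kt) 0 → lieSU (Fin 2)) →L[ℝ] (Fin (constrCard (Bj ν.M₁ Z k) k) → lieSU (Fin 2))}
    (hΨ₂ : HasFDerivAt (fun Y => fderiv ℝ (msChart F 2 Kt k (Bj ν.M₁ Z k) (avgFamily (Node00.avOfRecord F 2 Kt) (qsstarGIter0 k (ext Vk))) U₀) Y) Ψ₂ 0)
    (hΨd : ∀ᶠ Y in 𝓝 (0 : PBond (F.P Kt) 0 → lieSU (Fin 2)), DifferentiableAt ℝ (msChart F 2 Kt k (Bj ν.M₁ Z k) (avgFamily (Node00.avOfRecord F 2 Kt) (qsstarGIter0 k (ext Vk))) U₀) Y)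
    {lam : (Fin (constrCard (Bj ν.M₁ Z k) k) → lieSU (Fin 2)) →L[ℝ] ℝ}
    (hlam : fderiv ℝ (fun Y : PBond (F.P Kt) 0 → lieSU (Fin 2) => wilsonAction4 (expChart U₀ Y)) 0 =
      lam.comp (fderiv ℝ (msChart F 2 Kt k (Bj ν.M₁ Z k) (avgFamily (Node00.avOfRecord F 2 Kt) (qsstarGIter0 k (ext Vk))) U₀) 0))
    (p : Seminorm ℝ (PBond (F.P Kt) 0 → lieSU (Fin 2))) (hp : ∀ Y : PBond (F.P Kt) 0 → lieSU (Fin 2), ∑ b, ‖(Y b : Matrix (Fin 2) (Fin 2) ℂ)‖ ^ 2 ≤ p Y ^ 2)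
    (hX : ∀ X : GaugeSlice (pts k Λ) T E3,
      lam (Ψ₂ (fderiv ℝ Xf 0 X) (fderiv ℝ Xf 0 X)) ≤ μ * p (fderiv ℝ Xf 0 X) ^ 2 ∧
      p (fderiv ℝ Xf 0 X) ≤ Kc * ‖X‖ ∧
      γ₀ * (∑ z ∈ box (fun κ => (hi κ - lo κ + 1).toNat + 3) (fun κ => lo κ - 2), ∑ μ : Fin (F.P Kt).d, ∑ a : Fin 3,
            curl (fun b => ιA (pts k Λ) T X (⟨castSite b.1, b.2⟩ : PBond (F.P Kt) k) a) z ⟨0, h0⟩ μ ^ 2) - τ * ‖X‖ ^ 2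
        ≤ ((Fintype.card (Fin 2) : ℝ)⁻¹ • ∑ p ∈ W, (innerSL ℝ (E := lieSU (Fin 2))).bilinearComp
            (ContinuousLinearMap.proj (R := ℝ) (φ := fun _ : PBond (F.P Kt) 0 => lieSU (Fin 2)) (⟨p.src, p.μ⟩ : PBond (F.P Kt) 0) + ContinuousLinearMap.proj (R := ℝ) (φ := fun _ : PBond (F.P Kt) 0 => lieSU (Fin 2)) (⟨p.src.shift p.μ, p.ν⟩ : PBond (F.P Kt) 0)
              - ContinuousLinearMap.proj (R := ℝ) (φ := fun _ : PBond (F.P Kt) 0 => lieSU (Fin 2)) (⟨p.src.shift p.ν, p.μ⟩ : PBond (F.P Kt) 0) - ContinuousLinearMap.proj (R := ℝ) (φ := fun _ : PBond (F.P Kt) 0 => lieSU (Fin 2)) (⟨p.src, p.ν⟩ : PBond (F.P Kt) 0))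
            (ContinuousLinearMap.proj (R := ℝ) (φ := fun _ : PBond (F.P Kt) 0 => lieSU (Fin 2)) (⟨p.src, p.μ⟩ : PBond (F.P Kt) 0) + ContinuousLinearMap.proj (R := ℝ) (φ := fun _ : PBond (F.P Kt) 0 => lieSU (Fin 2)) (⟨p.src.shift p.μ, p.ν⟩ : PBond (F.P Kt) 0)
              - ContinuousLinearMap.proj (R := ℝ) (φ := fun _ : PBond (F.P Kt) 0 => lieSU (Fin 2)) (⟨p.src.shift p.ν, p.μ⟩ : PBond (F.P Kt) 0) - ContinuousLinearMap.proj (R := ℝ) (φ := fun _ : PBond (F.P Kt) 0 => lieSU (Fin 2)) (⟨p.src, p.ν⟩ : PBond (F.P Kt) 0))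
            : (PBond (F.P Kt) 0 → lieSU (Fin 2)) →L[ℝ] (PBond (F.P Kt) 0 → lieSU (Fin 2)) →L[ℝ] ℝ) (fderiv ℝ Xf 0 X) (fderiv ℝ Xf 0 X))
    (hsm : (32 * (((F.P Kt).d : ℝ) - 1) * δ + 8 * (((F.P Kt).d : ℝ) - 1) * ε + μ) * Kc ^ 2 + τ ≤ γ₀ / (2 * (3 * (K : ℝ) ^ 2 + 2 * (K : ℝ) ^ 4)))
    (hγle : γ / M ^ 5 ≤ γ₀ / (2 * (3 * (K : ℝ) ^ 2 + 2 * (K : ℝ) ^ 4)))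
    (X : GaugeSlice (pts k Λ) T E3) :
    γ / M ^ 5 * ‖X‖ ^ 2
      ≤ ⟪X, fderiv ℝ (rGrad (pts k Λ) T (sliceFn (pts k Λ) T (fun177std (Node00.bgMSCoPOfRecord F 2 ν Kt k (maxDomT ν.M₁ Z)) ν.M₁ Z k) (ext Vk))) 0 X⟫_ℝ :=
  hessian_coercive_of_h17_ofDec (hdec := inferInstance) (Subsingleton.elim _ _) hd3 h0 hbox hTG0 hN5 hK1 hKn hγ₀
    (sliceFn (pts k Λ) T (fun177std (Node00.bgMSCoPOfRecord F 2 ν Kt k (maxDomT ν.M₁ Z)) ν.M₁ Z k) (ext Vk))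
    (fun X => h17Clause_of_windowLetters_direct ν Kt hk0 hk Z Λ T ext Vk hfar
      (fun X => ∑ z ∈ box (fun κ => (hi κ - lo κ + 1).toNat + 3) (fun κ => lo κ - 2), ∑ μ : Fin (F.P Kt).d, ∑ a : Fin 3,
        curl (fun b => ιA (pts k Λ) T X (⟨castSite b.1, b.2⟩ : PBond (F.P Kt) k) a) z ⟨0, h0⟩ μ ^ 2)
      hδ0 hε0 hμ0 U₀ W hUwin hPfar Xf hX₀ hXc hmin hΨ₂ hΨd hlam p hp hX X)
    hsm hγle X

end DirectRecord

/-! ## §4  The family letter of the DIRECT road: (1.9) `hcoer` at every guarded base field from the window∕direct package at the gauge-normalisable data (the socket text) -/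

section DirectFamily

variable {F : T4Family}

/-- ★★★ **THE (1.9) FAMILY LETTER `hcoer` FROM THE WINDOW∕DIRECT PACKAGE — the socket text of the direct road.**  As this lane's general-region family letter
`B15Prop1CoerciveAtNormalisedDatum.hcoer_of_nearFlatLettersGaugeNormalisable_sub_loc` (p627443 §5: per instance a bond set `𝒞 i` and tolerance `ρn i` with the displayed normaliser
`hgauge`; the package asked only at guarded base fields whose extended datum is `ρn i`-near `1` on `𝒞 i`), with the package (N) REPLACED by the direct window package (WD): SOME `U₀`,
SOME real `C²` family `X_f` of (2.12) minimisers in the exponential chart at `U₀` along the slice, SOME finite window `W` of plaquettes with `U₀` bond-wise `δc i`-near `1` on `W`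
(C1_window) and PLAQUETTE `εc i`-small on the other plaquettes with a bond starting in `Ω₁(Z_i)` (P1), the chart's second derivative `Ψ₂`, differentiability, a multiplier `λ` with the
Lagrange form, a seminorm `p ≥ (Σ_b‖·‖²_op)^{1∕2}`, and per slice vector the rows (μ) `λ(Ψ₂(X_f′X,X_f′X)) ≤ μc i·p(X_f′X)²`, (K) `p(X_f′X) ≤ Kc i·‖X‖` and the Federbush letter AT THE
VELOCITY `γ₀·circ_i X − τc i·‖X‖² ≤ B_W(X_f′X, X_f′X)`.  NO flat linearisation, NO right inverse, NO (δ₂).  Numerics: `hsm : (32(d−1)δc i + 8(d−1)εc i + μc i)·(Kc i)² + τc i ≤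
γ₀∕(2(3K_i²+2K_i⁴))`, `hγle`.  Conclusion: the `_ofCoercive` chain's letter `hcoer` verbatim.  Proof: p623795 §2 `sliceCoercive_of_gaugeNormalisable` at the background of record with
`hnorm` supplied by §3's `sliceCoercive_of_windowLetters_direct`.
[cite: Balaban1989LargeFieldI, (1.74) p.192, p.193, (1.77) and the sentence after it, Prop. 1 p.194; Balaban1989LargeFieldII, p.357, (1.7)–(1.9) p.358, (1.12)–(1.13) p.359; Balaban1985BackgroundPropagators, (3.8) p.391, (3.10) p.392; Balaban1985Variational, (47) p.285, (81) p.290, Prop. 9 (190) p.309; Balaban1988Convergent, (2.2) p.255, (2.12)–(2.13) pp.256–257] -/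
theorem hcoer_of_windowLettersDirect_gaugeNormalisable
    (ν : Node00.Stage7Numerics) (Kt : ℕ) (hd3 : 3 ≤ (F.P Kt).d) (h0 : 0 < (F.P Kt).d) {ι : Type}
    (Z Λ : ι → Set (Site (F.P Kt) 0)) (k : ι → ℕ) (M : ι → ℝ) (hk0 : ∀ i, 0 < k i) (hk : ∀ i, k i ≤ (F.P Kt).m + (F.P Kt).K)
    (eR : ι → ℝ)
    (T : ∀ i, Finset (PBond (F.P Kt) (k i)))
    (lo hi : ι → Fin (F.P Kt).d → ℤ)
    (hbox : ∀ i, pts (k i) (Λ i) = (castSite '' Set.Icc (lo i) (hi i) : Set (Site (F.P Kt) (k i))))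
    (hTG0 : ∀ i, T i = (box (fun κ => (hi i κ - lo i κ + 1).toNat) (lo i)).image fun x =>
      (⟨castSite (x - unitVec ⟨0, h0⟩), ⟨0, h0⟩⟩ : PBond (F.P Kt) (k i)))
    (hN5 : ∀ i κ, ((hi i κ - lo i κ + 1).toNat : ℤ) + 5 < (F.P Kt).sitesPerDir (k i))
    (K : ι → ℕ) (hK1 : ∀ i, 1 ≤ K i) (hKn : ∀ i κ, (hi i κ - lo i κ + 1).toNat ≤ K i)
    (ext : ∀ i, GaugeField (F.P Kt) (k i) SU2 → GaugeField (F.P Kt) (k i) SU2)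
    (hext : ∀ i Vk, ext i Vk = extend (pts (k i) (Λ i)) (shellGauge Vk (lo i) (hi i)) Vk)
    -- the NORMALISATION, displayed (as in p627443 §5)
    (𝒞 : ∀ i, Set (PBond (F.P Kt) (k i))) (ρn : ι → ℝ)
    (hgauge : ∀ i (Vk : GaugeField (F.P Kt) (k i) SU2), PlaqSmallOn (plaqsInside (pts (k i) (Z i ∩ (Λ i)ᶜ))) (eR i) Vk →
      ∃ u : GaugeTransf (F.P Kt) (k i) SU2, (∀ s ∈ pts (k i) (Λ i), u s = 1) ∧ u (castSite (lo i - 1)) = 1 ∧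
        ∀ b ∈ 𝒞 i, dist1 (gaugeAct u (ext i Vk) b) ≤ ρn i)
    {γ : ℝ} {γ₀ : ℝ} (hγ₀ : 0 ≤ γ₀)
    -- (WD) THE WINDOW∕DIRECT LETTER PACKAGE per instance, asked ONLY at the guarded base fields whose extended datum is `ρn i`-near `1` on `𝒞 i`
    {δc εc μc Kc τc : ι → ℝ} (hδc0 : ∀ i, 0 ≤ δc i) (hεc0 : ∀ i, 0 ≤ εc i) (hμc0 : ∀ i, 0 ≤ μc i)
    (hWD : ∀ i (Vk : GaugeField (F.P Kt) (k i) SU2), PlaqSmallOn (plaqsInside (pts (k i) (Z i ∩ (Λ i)ᶜ))) (eR i) Vk →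
      (∀ b ∈ 𝒞 i, dist1 (ext i Vk b) ≤ ρn i) →
      ∃ (U₀ : GaugeField (F.P Kt) 0 SU2) (Xf : GaugeSlice (pts (k i) (Λ i)) (T i) E3 → PBond (F.P Kt) 0 → lieSU (Fin 2)) (W : Finset (Plaq (F.P Kt) 0)),
        -- C1_window
        (∀ p ∈ W, ‖((U₀ ⟨p.src, p.μ⟩ : SU2) : Matrix (Fin 2) (Fin 2) ℂ) - 1‖ ≤ δc i ∧ ‖((U₀ ⟨p.src.shift p.μ, p.ν⟩ : SU2) : Matrix (Fin 2) (Fin 2) ℂ) - 1‖ ≤ δc i ∧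
            ‖((U₀ ⟨p.src.shift p.ν, p.μ⟩ : SU2) : Matrix (Fin 2) (Fin 2) ℂ) - 1‖ ≤ δc i ∧ ‖((U₀ ⟨p.src, p.ν⟩ : SU2) : Matrix (Fin 2) (Fin 2) ℂ) - 1‖ ≤ δc i) ∧
        -- P1
        (∀ p ∉ W, ((⟨p.src, p.μ⟩ : PBond (F.P Kt) 0) ∈ {b : PBond (F.P Kt) 0 | b.src ∈ maxDomT ν.M₁ (Z i) 1} ∨
            (⟨p.src.shift p.μ, p.ν⟩ : PBond (F.P Kt) 0) ∈ {b : PBond (F.P Kt) 0 | b.src ∈ maxDomT ν.M₁ (Z i) 1} ∨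
            (⟨p.src.shift p.ν, p.μ⟩ : PBond (F.P Kt) 0) ∈ {b : PBond (F.P Kt) 0 | b.src ∈ maxDomT ν.M₁ (Z i) 1} ∨
            (⟨p.src, p.ν⟩ : PBond (F.P Kt) 0) ∈ {b : PBond (F.P Kt) 0 | b.src ∈ maxDomT ν.M₁ (Z i) 1}) →
          ‖((GaugeField.plaqHol U₀ p : SU2) : Matrix (Fin 2) (Fin 2) ℂ) - 1‖ ≤ εc i) ∧
        Xf 0 = 0 ∧ ContDiffAt ℝ 2 Xf 0 ∧
        (∀ᶠ Y in 𝓝 (0 : GaugeSlice (pts (k i) (Λ i)) (T i) E3),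
          IsMinimizer (Node00.avOfRecord F 2 Kt) (Node00.regMSCoPOfRecord F 2 ν Kt (k i) (maxDomT ν.M₁ (Z i))) (Bj ν.M₁ (Z i) (k i))
            (avgFamily (Node00.avOfRecord F 2 Kt) (qsstarGIter0 (k i) (expMul su2Chart (ιA (pts (k i) (Λ i)) (T i) Y) (ext i Vk)))) (expChart U₀ (Xf Y))) ∧
        ∃ (Ψ₂ : (PBond (F.P Kt) 0 → lieSU (Fin 2)) →L[ℝ] (PBond (F.P Kt) 0 → lieSU (Fin 2)) →L[ℝ] (Fin (constrCard (Bj ν.M₁ (Z i) (k i)) (k i)) → lieSU (Fin 2)))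
          (lam : (Fin (constrCard (Bj ν.M₁ (Z i) (k i)) (k i)) → lieSU (Fin 2)) →L[ℝ] ℝ)
          (p : Seminorm ℝ (PBond (F.P Kt) 0 → lieSU (Fin 2))),
          HasFDerivAt (fun Y => fderiv ℝ (msChart F 2 Kt (k i) (Bj ν.M₁ (Z i) (k i)) (avgFamily (Node00.avOfRecord F 2 Kt) (qsstarGIter0 (k i) (ext i Vk))) U₀) Y) Ψ₂ 0 ∧
          (∀ᶠ Y in 𝓝 (0 : PBond (F.P Kt) 0 → lieSU (Fin 2)),
            DifferentiableAt ℝ (msChart F 2 Kt (k i) (Bj ν.M₁ (Z i) (k i)) (avgFamily (Node00.avOfRecord F 2 Kt) (qsstarGIter0 (k i) (ext i Vk))) U₀) Y) ∧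
          fderiv ℝ (fun Y : PBond (F.P Kt) 0 → lieSU (Fin 2) => wilsonAction4 (expChart U₀ Y)) 0 =
            lam.comp (fderiv ℝ (msChart F 2 Kt (k i) (Bj ν.M₁ (Z i) (k i)) (avgFamily (Node00.avOfRecord F 2 Kt) (qsstarGIter0 (k i) (ext i Vk))) U₀) 0) ∧
          (∀ Y : PBond (F.P Kt) 0 → lieSU (Fin 2), ∑ b, ‖(Y b : Matrix (Fin 2) (Fin 2) ℂ)‖ ^ 2 ≤ p Y ^ 2) ∧
          ∀ X : GaugeSlice (pts (k i) (Λ i)) (T i) E3,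
            lam (Ψ₂ (fderiv ℝ Xf 0 X) (fderiv ℝ Xf 0 X)) ≤ μc i * p (fderiv ℝ Xf 0 X) ^ 2 ∧
            p (fderiv ℝ Xf 0 X) ≤ Kc i * ‖X‖ ∧
            γ₀ * (∑ z ∈ box (fun κ => (hi i κ - lo i κ + 1).toNat + 3) (fun κ => lo i κ - 2), ∑ μ : Fin (F.P Kt).d, ∑ a : Fin 3,
                  curl (fun b => ιA (pts (k i) (Λ i)) (T i) X (⟨castSite b.1, b.2⟩ : PBond (F.P Kt) (k i)) a) z ⟨0, h0⟩ μ ^ 2) - τc i * ‖X‖ ^ 2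
              ≤ ((Fintype.card (Fin 2) : ℝ)⁻¹ • ∑ p ∈ W, (innerSL ℝ (E := lieSU (Fin 2))).bilinearComp
              (ContinuousLinearMap.proj (R := ℝ) (φ := fun _ : PBond (F.P Kt) 0 => lieSU (Fin 2)) (⟨p.src, p.μ⟩ : PBond (F.P Kt) 0) + ContinuousLinearMap.proj (R := ℝ) (φ := fun _ : PBond (F.P Kt) 0 => lieSU (Fin 2)) (⟨p.src.shift p.μ, p.ν⟩ : PBond (F.P Kt) 0)
                - ContinuousLinearMap.proj (R := ℝ) (φ := fun _ : PBond (F.P Kt) 0 => lieSU (Fin 2)) (⟨p.src.shift p.ν, p.μ⟩ : PBond (F.P Kt) 0) - ContinuousLinearMap.proj (R := ℝ) (φ := fun _ : PBond (F.P Kt) 0 => lieSU (Fin 2)) (⟨p.src, p.ν⟩ : PBond (F.P Kt) 0))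
              (ContinuousLinearMap.proj (R := ℝ) (φ := fun _ : PBond (F.P Kt) 0 => lieSU (Fin 2)) (⟨p.src, p.μ⟩ : PBond (F.P Kt) 0) + ContinuousLinearMap.proj (R := ℝ) (φ := fun _ : PBond (F.P Kt) 0 => lieSU (Fin 2)) (⟨p.src.shift p.μ, p.ν⟩ : PBond (F.P Kt) 0)
                - ContinuousLinearMap.proj (R := ℝ) (φ := fun _ : PBond (F.P Kt) 0 => lieSU (Fin 2)) (⟨p.src.shift p.ν, p.μ⟩ : PBond (F.P Kt) 0) - ContinuousLinearMap.proj (R := ℝ) (φ := fun _ : PBond (F.P Kt) 0 => lieSU (Fin 2)) (⟨p.src, p.ν⟩ : PBond (F.P Kt) 0))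
              : (PBond (F.P Kt) 0 → lieSU (Fin 2)) →L[ℝ] (PBond (F.P Kt) 0 → lieSU (Fin 2)) →L[ℝ] ℝ) (fderiv ℝ Xf 0 X) (fderiv ℝ Xf 0 X))
    -- numerics: the assembled DIRECT `Cerr i` is small, and the positivity constant fits
    (hsm : ∀ i, (32 * (((F.P Kt).d : ℝ) - 1) * δc i + 8 * (((F.P Kt).d : ℝ) - 1) * εc i + μc i) * Kc i ^ 2 + τc i
      ≤ γ₀ / (2 * (3 * (K i : ℝ) ^ 2 + 2 * (K i : ℝ) ^ 4)))
    (hγle : ∀ i, γ / (M i) ^ 5 ≤ γ₀ / (2 * (3 * (K i : ℝ) ^ 2 + 2 * (K i : ℝ) ^ 4)))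
    (hfar : ∀ i (b : PBond (F.P Kt) 0), b.src ∉ maxDomT ν.M₁ (Z i) 1 →
      (⟨blockIter (k i) b.src, b.dir⟩ : PBond (F.P Kt) (k i)) ∉ bondsOf (pts (k i) (Λ i)))
    : ∀ i (Vk : GaugeField (F.P Kt) (k i) SU2), PlaqSmallOn (plaqsInside (pts (k i) (Z i ∩ (Λ i)ᶜ))) (eR i) Vk →
      ∀ X : GaugeSlice (pts (k i) (Λ i)) (T i) E3,
        γ / (M i) ^ 5 * ‖X‖ ^ 2 ≤ ⟪X, (fderiv ℝ (rGrad (pts (k i) (Λ i)) (T i)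
          (sliceFn (pts (k i) (Λ i)) (T i)
            (fun177std (Node00.bgMSCoPOfRecord F 2 ν Kt (k i) (maxDomT ν.M₁ (Z i))) ν.M₁ (Z i) (k i)) (ext i Vk))) 0) X⟫_ℝ := by
  intro i Vk hV X
  -- the box is non-wrapping with margin (from `hN5`)
  have hN : ∀ κ, hi i κ - lo i κ + 3 < ((F.P Kt).sitesPerDir (k i) : ℤ) := fun κ => by
    have h5 := hN5 i κ
    have : hi i κ - lo i κ + 1 ≤ ((hi i κ - lo i κ + 1).toNat : ℤ) := Int.self_le_toNat _
    linarith
  refine B15Prop1CoerciveAtNormalisedDatum.sliceCoercive_of_gaugeNormalisable hN (hbox i) (ext i) (hext i)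
    (fun u W => fun177std_bgMSCoPOfRecord_gaugeAct ν Kt (k i) (maxDomT ν.M₁ (Z i)) ν.M₁ (Z i) (hk i) u W) (T i) (γ / (M i) ^ 5)
    (𝒞 i) (ρn i) (hgauge i) (fun V hV' hnV X' => ?_) Vk hV X
  -- (1.9) at a normalised base field from the window∕direct package there (§3)
  obtain ⟨U₀, Xf, W, hUwin, hPfar, hX₀, hXc, hmin, Ψ₂, lam, p, hΨ₂, hΨd, hlam, hp, hX⟩ := hWD i V hV' hnV
  exact sliceCoercive_of_windowLetters_direct ν Kt hd3 h0 (hk0 i) (hk i) (Z i) (Λ i) (T i) (hbox i) (hTG0 i) (hN5 i) (hK1 i) (hKn i)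
    (ext i) V (hfar i) hγ₀ (hδc0 i) (hεc0 i) (hμc0 i) U₀ W hUwin hPfar Xf hX₀ hXc hmin hΨ₂ hΨd hlam p hp hX (hsm i) (hγle i) X'

end DirectFamily

/-! ## §5  (v1.1) The family letter of the DIRECT road — BOX-NORMALISER EDITION (the shape dag-n12-w5's (ii)∕(iii) consume: region parallelepipeds `[LO i, HI i]`, dag-n12-w6's normaliser inside) -/

section DirectFamilyBox

variable {F : T4Family}

/-- ★★★ **THE (1.9) FAMILY LETTER `hcoer` FROM THE WINDOW∕DIRECT PACKAGE — BOX-NORMALISER EDITION.**  As this lane's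
`B15Prop1CoerciveAtNormalisedDatum.hcoer_of_nearFlatLettersNormalised_sub_loc` (p623795 §3: per instance a REGION parallelepiped `[LO i, HI i] ⊇ [lo i − 1, hi i + 1]` of at most
`n′ i + 1` sites per direction, non-wrapping, plaquettes in `Z_i^{(k)}`, datum tolerance `ρn i ≥ (d·n′ i + 1)·((d − 1)n′ i·(12d(n i + 2)² + 1) + 3d(n i + 2)²)·eR i`; the package asked only
at guarded base fields whose extended datum is `ρn i`-near `1` on the region box — dag-n12-w6's box normaliser discharges the gauge inside), with the package (N) REPLACED by the
window∕direct package (WD) of §4 (C1_window `δc i` on a finite window `W`, P1 `εc i` off it, (μ), (K), Federbush letter at the velocity against `B_W`; no `L♭ ∕ R♭ ∕ q ∕ ρ ∕ δ₂`);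
numerics `hsm : (32(d−1)δc i + 8(d−1)εc i + μc i)·(Kc i)² + τc i ≤ γ₀∕(2(3K_i²+2K_i⁴))`, `hγle`.  Conclusion: the `_ofCoercive` chain's `hcoer` verbatim — the binder list of
dag-n12-w5's `B15Prop1EndpointFromLetterFamiliesLoc` §2 call with `hNFn` ↦ `hWD`.  Proof: p623795 §2 `sliceCoercive_fun177std_bgMSCoPOfRecord_of_normalised` with `hnorm` from §3's
`sliceCoercive_of_windowLetters_direct`.
[cite: Balaban1989LargeFieldI, (1.74) p.192, p.193, (1.77) and the sentence after it, Prop. 1 p.194; Balaban1989LargeFieldII, p.357, (1.7)–(1.9) p.358, (1.12)–(1.13) p.359; Balaban1985BackgroundPropagators, (3.8) p.391, (3.10) p.392; Balaban1985Variational, (47) p.285, (81) p.290, Prop. 9 (190) p.309; Balaban1988Convergent, (2.2) p.255, (2.12)–(2.13) pp.256–257] -/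
theorem hcoer_of_windowLettersDirect_normalised_box
    (ν : Node00.Stage7Numerics) (Kt : ℕ) (hd3 : 3 ≤ (F.P Kt).d) (h0 : 0 < (F.P Kt).d) {ι : Type}
    (Z Λ : ι → Set (Site (F.P Kt) 0)) (k : ι → ℕ) (M : ι → ℝ) (hk0 : ∀ i, 0 < k i) (hk : ∀ i, k i ≤ (F.P Kt).m + (F.P Kt).K)
    (eR : ι → ℝ) (heR : ∀ i, 0 < eR i)
    (T : ∀ i, Finset (PBond (F.P Kt) (k i)))
    (lo hi : ι → Fin (F.P Kt).d → ℤ) (n : ι → ℕ) (hn : ∀ i κ, hi i κ ≤ lo i κ + n i)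
    (hbox : ∀ i, pts (k i) (Λ i) = (castSite '' Set.Icc (lo i) (hi i) : Set (Site (F.P Kt) (k i))))
    (hZ : ∀ i, (boxPlaqs (lo i - 1) (hi i + 1) : Set (Plaq (F.P Kt) (k i))) ⊆ plaqsInside (pts (k i) (Z i)))
    (hTG0 : ∀ i, T i = (box (fun κ => (hi i κ - lo i κ + 1).toNat) (lo i)).image fun x =>
      (⟨castSite (x - unitVec ⟨0, h0⟩), ⟨0, h0⟩⟩ : PBond (F.P Kt) (k i)))
    (hN5 : ∀ i κ, ((hi i κ - lo i κ + 1).toNat : ℤ) + 5 < (F.P Kt).sitesPerDir (k i))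
    (K : ι → ℕ) (hK1 : ∀ i, 1 ≤ K i) (hKn : ∀ i κ, (hi i κ - lo i κ + 1).toNat ≤ K i)
    (ext : ∀ i, GaugeField (F.P Kt) (k i) SU2 → GaugeField (F.P Kt) (k i) SU2)
    (hext : ∀ i Vk, ext i Vk = extend (pts (k i) (Λ i)) (shellGauge Vk (lo i) (hi i)) Vk)
    (hlohi : ∀ i, lo i ≤ hi i)
    -- the REGION parallelepipeds of the normalisation and the datum tolerances
    (LO HI : ι → Fin (F.P Kt).d → ℤ) (hLO : ∀ i, LO i ≤ lo i - 1) (hHI : ∀ i, hi i + 1 ≤ HI i) (n' : ι → ℕ) (hn' : ∀ i κ, HI i κ ≤ LO i κ + n' i)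
    (hn'N : ∀ i, n' i < (F.P Kt).sitesPerDir (k i)) (hR : ∀ i, (boxPlaqs (LO i) (HI i) : Set (Plaq (F.P Kt) (k i))) ⊆ plaqsInside (pts (k i) (Z i)))
    (ρn : ι → ℝ)
    (hρn : ∀ i, (((F.P Kt).d : ℝ) * n' i + 1) * ((((F.P Kt).d - 1 : ℕ) : ℝ) * n' i * ((12 * (F.P Kt).d * (n i + 2) ^ 2 + 1) * eR i)
      + 3 * (F.P Kt).d * (n i + 2) ^ 2 * eR i) ≤ ρn i)
    {γ : ℝ} {γ₀ : ℝ} (hγ₀ : 0 ≤ γ₀)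
    -- (WD) THE WINDOW∕DIRECT LETTER PACKAGE per instance, asked ONLY at the guarded base fields whose extended datum is `ρn i`-near `1` on the region box
    {δc εc μc Kc τc : ι → ℝ} (hδc0 : ∀ i, 0 ≤ δc i) (hεc0 : ∀ i, 0 ≤ εc i) (hμc0 : ∀ i, 0 ≤ μc i)
    (hWD : ∀ i (Vk : GaugeField (F.P Kt) (k i) SU2), PlaqSmallOn (plaqsInside (pts (k i) (Z i ∩ (Λ i)ᶜ))) (eR i) Vk →
      (∀ b ∈ (boxBonds (LO i) (HI i) : Set (PBond (F.P Kt) (k i))), dist1 (ext i Vk b) ≤ ρn i) →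
      ∃ (U₀ : GaugeField (F.P Kt) 0 SU2) (Xf : GaugeSlice (pts (k i) (Λ i)) (T i) E3 → PBond (F.P Kt) 0 → lieSU (Fin 2)) (W : Finset (Plaq (F.P Kt) 0)),
        -- C1_window
        (∀ p ∈ W, ‖((U₀ ⟨p.src, p.μ⟩ : SU2) : Matrix (Fin 2) (Fin 2) ℂ) - 1‖ ≤ δc i ∧ ‖((U₀ ⟨p.src.shift p.μ, p.ν⟩ : SU2) : Matrix (Fin 2) (Fin 2) ℂ) - 1‖ ≤ δc i ∧
            ‖((U₀ ⟨p.src.shift p.ν, p.μ⟩ : SU2) : Matrix (Fin 2) (Fin 2) ℂ) - 1‖ ≤ δc i ∧ ‖((U₀ ⟨p.src, p.ν⟩ : SU2) : Matrix (Fin 2) (Fin 2) ℂ) - 1‖ ≤ δc i) ∧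
        -- P1
        (∀ p ∉ W, ((⟨p.src, p.μ⟩ : PBond (F.P Kt) 0) ∈ {b : PBond (F.P Kt) 0 | b.src ∈ maxDomT ν.M₁ (Z i) 1} ∨
            (⟨p.src.shift p.μ, p.ν⟩ : PBond (F.P Kt) 0) ∈ {b : PBond (F.P Kt) 0 | b.src ∈ maxDomT ν.M₁ (Z i) 1} ∨
            (⟨p.src.shift p.ν, p.μ⟩ : PBond (F.P Kt) 0) ∈ {b : PBond (F.P Kt) 0 | b.src ∈ maxDomT ν.M₁ (Z i) 1} ∨
            (⟨p.src, p.ν⟩ : PBond (F.P Kt) 0) ∈ {b : PBond (F.P Kt) 0 | b.src ∈ maxDomT ν.M₁ (Z i) 1}) →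
          ‖((GaugeField.plaqHol U₀ p : SU2) : Matrix (Fin 2) (Fin 2) ℂ) - 1‖ ≤ εc i) ∧
        Xf 0 = 0 ∧ ContDiffAt ℝ 2 Xf 0 ∧
        (∀ᶠ Y in 𝓝 (0 : GaugeSlice (pts (k i) (Λ i)) (T i) E3),
          IsMinimizer (Node00.avOfRecord F 2 Kt) (Node00.regMSCoPOfRecord F 2 ν Kt (k i) (maxDomT ν.M₁ (Z i))) (Bj ν.M₁ (Z i) (k i))
            (avgFamily (Node00.avOfRecord F 2 Kt) (qsstarGIter0 (k i) (expMul su2Chart (ιA (pts (k i) (Λ i)) (T i) Y) (ext i Vk)))) (expChart U₀ (Xf Y))) ∧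
        ∃ (Ψ₂ : (PBond (F.P Kt) 0 → lieSU (Fin 2)) →L[ℝ] (PBond (F.P Kt) 0 → lieSU (Fin 2)) →L[ℝ] (Fin (constrCard (Bj ν.M₁ (Z i) (k i)) (k i)) → lieSU (Fin 2)))
          (lam : (Fin (constrCard (Bj ν.M₁ (Z i) (k i)) (k i)) → lieSU (Fin 2)) →L[ℝ] ℝ)
          (p : Seminorm ℝ (PBond (F.P Kt) 0 → lieSU (Fin 2))),
          HasFDerivAt (fun Y => fderiv ℝ (msChart F 2 Kt (k i) (Bj ν.M₁ (Z i) (k i)) (avgFamily (Node00.avOfRecord F 2 Kt) (qsstarGIter0 (k i) (ext i Vk))) U₀) Y) Ψ₂ 0 ∧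
          (∀ᶠ Y in 𝓝 (0 : PBond (F.P Kt) 0 → lieSU (Fin 2)),
            DifferentiableAt ℝ (msChart F 2 Kt (k i) (Bj ν.M₁ (Z i) (k i)) (avgFamily (Node00.avOfRecord F 2 Kt) (qsstarGIter0 (k i) (ext i Vk))) U₀) Y) ∧
          fderiv ℝ (fun Y : PBond (F.P Kt) 0 → lieSU (Fin 2) => wilsonAction4 (expChart U₀ Y)) 0 =
            lam.comp (fderiv ℝ (msChart F 2 Kt (k i) (Bj ν.M₁ (Z i) (k i)) (avgFamily (Node00.avOfRecord F 2 Kt) (qsstarGIter0 (k i) (ext i Vk))) U₀) 0) ∧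
          (∀ Y : PBond (F.P Kt) 0 → lieSU (Fin 2), ∑ b, ‖(Y b : Matrix (Fin 2) (Fin 2) ℂ)‖ ^ 2 ≤ p Y ^ 2) ∧
          ∀ X : GaugeSlice (pts (k i) (Λ i)) (T i) E3,
            lam (Ψ₂ (fderiv ℝ Xf 0 X) (fderiv ℝ Xf 0 X)) ≤ μc i * p (fderiv ℝ Xf 0 X) ^ 2 ∧
            p (fderiv ℝ Xf 0 X) ≤ Kc i * ‖X‖ ∧
            γ₀ * (∑ z ∈ box (fun κ => (hi i κ - lo i κ + 1).toNat + 3) (fun κ => lo i κ - 2), ∑ μ : Fin (F.P Kt).d, ∑ a : Fin 3,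
                  curl (fun b => ιA (pts (k i) (Λ i)) (T i) X (⟨castSite b.1, b.2⟩ : PBond (F.P Kt) (k i)) a) z ⟨0, h0⟩ μ ^ 2) - τc i * ‖X‖ ^ 2
              ≤ ((Fintype.card (Fin 2) : ℝ)⁻¹ • ∑ p ∈ W, (innerSL ℝ (E := lieSU (Fin 2))).bilinearComp
              (ContinuousLinearMap.proj (R := ℝ) (φ := fun _ : PBond (F.P Kt) 0 => lieSU (Fin 2)) (⟨p.src, p.μ⟩ : PBond (F.P Kt) 0) + ContinuousLinearMap.proj (R := ℝ) (φ := fun _ : PBond (F.P Kt) 0 => lieSU (Fin 2)) (⟨p.src.shift p.μ, p.ν⟩ : PBond (F.P Kt) 0)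
                - ContinuousLinearMap.proj (R := ℝ) (φ := fun _ : PBond (F.P Kt) 0 => lieSU (Fin 2)) (⟨p.src.shift p.ν, p.μ⟩ : PBond (F.P Kt) 0) - ContinuousLinearMap.proj (R := ℝ) (φ := fun _ : PBond (F.P Kt) 0 => lieSU (Fin 2)) (⟨p.src, p.ν⟩ : PBond (F.P Kt) 0))
              (ContinuousLinearMap.proj (R := ℝ) (φ := fun _ : PBond (F.P Kt) 0 => lieSU (Fin 2)) (⟨p.src, p.μ⟩ : PBond (F.P Kt) 0) + ContinuousLinearMap.proj (R := ℝ) (φ := fun _ : PBond (F.P Kt) 0 => lieSU (Fin 2)) (⟨p.src.shift p.μ, p.ν⟩ : PBond (F.P Kt) 0)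
                - ContinuousLinearMap.proj (R := ℝ) (φ := fun _ : PBond (F.P Kt) 0 => lieSU (Fin 2)) (⟨p.src.shift p.ν, p.μ⟩ : PBond (F.P Kt) 0) - ContinuousLinearMap.proj (R := ℝ) (φ := fun _ : PBond (F.P Kt) 0 => lieSU (Fin 2)) (⟨p.src, p.ν⟩ : PBond (F.P Kt) 0))
              : (PBond (F.P Kt) 0 → lieSU (Fin 2)) →L[ℝ] (PBond (F.P Kt) 0 → lieSU (Fin 2)) →L[ℝ] ℝ) (fderiv ℝ Xf 0 X) (fderiv ℝ Xf 0 X))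
    -- numerics: the assembled DIRECT `Cerr i` is small, and the positivity constant fits
    (hsm : ∀ i, (32 * (((F.P Kt).d : ℝ) - 1) * δc i + 8 * (((F.P Kt).d : ℝ) - 1) * εc i + μc i) * Kc i ^ 2 + τc i
      ≤ γ₀ / (2 * (3 * (K i : ℝ) ^ 2 + 2 * (K i : ℝ) ^ 4)))
    (hγle : ∀ i, γ / (M i) ^ 5 ≤ γ₀ / (2 * (3 * (K i : ℝ) ^ 2 + 2 * (K i : ℝ) ^ 4)))
    (hfar : ∀ i (b : PBond (F.P Kt) 0), b.src ∉ maxDomT ν.M₁ (Z i) 1 →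
      (⟨blockIter (k i) b.src, b.dir⟩ : PBond (F.P Kt) (k i)) ∉ bondsOf (pts (k i) (Λ i)))
    : ∀ i (Vk : GaugeField (F.P Kt) (k i) SU2), PlaqSmallOn (plaqsInside (pts (k i) (Z i ∩ (Λ i)ᶜ))) (eR i) Vk →
      ∀ X : GaugeSlice (pts (k i) (Λ i)) (T i) E3,
        γ / (M i) ^ 5 * ‖X‖ ^ 2 ≤ ⟪X, (fderiv ℝ (rGrad (pts (k i) (Λ i)) (T i)
          (sliceFn (pts (k i) (Λ i)) (T i)
            (fun177std (Node00.bgMSCoPOfRecord F 2 ν Kt (k i) (maxDomT ν.M₁ (Z i))) ν.M₁ (Z i) (k i)) (ext i Vk))) 0) X⟫_ℝ := by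
  intro i Vk hV X
  -- the box is non-wrapping with margin (from `hN5`)
  have hN : ∀ κ, hi i κ - lo i κ + 3 < ((F.P Kt).sitesPerDir (k i) : ℤ) := fun κ => by
    have h5 := hN5 i κ
    have : hi i κ - lo i κ + 1 ≤ ((hi i κ - lo i κ + 1).toNat : ℤ) := Int.self_le_toNat _
    linarith
  refine B15Prop1CoerciveAtNormalisedDatum.sliceCoercive_fun177std_bgMSCoPOfRecord_of_normalised ν Kt (k i) (maxDomT ν.M₁ (Z i)) ν.M₁ (Z i) hd3 (hk i) (hlohi i)
    (hn i) hN (hbox i) (hZ i) (hLO i) (hHI i) (hn' i) (hn'N i) (hR i) (heR i) (hρn i) (ext i) (hext i) (T i) (γ / (M i) ^ 5)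
    (fun V hV' hnV X' => ?_) Vk hV X
  -- (1.9) at a normalised base field from the window∕direct package there (§3)
  obtain ⟨U₀, Xf, W, hUwin, hPfar, hX₀, hXc, hmin, Ψ₂, lam, p, hΨ₂, hΨd, hlam, hp, hX⟩ := hWD i V hV' hnV
  exact sliceCoercive_of_windowLetters_direct ν Kt hd3 h0 (hk0 i) (hk i) (Z i) (Λ i) (T i) (hbox i) (hTG0 i) (hN5 i) (hK1 i) (hKn i)
    (ext i) V (hfar i) hγ₀ (hδc0 i) (hεc0 i) (hμc0 i) U₀ W hUwin hPfar Xf hX₀ hXc hmin hΨ₂ hΨd hlam p hp hX (hsm i) (hγle i) X'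

end DirectFamilyBox

end Literature.MathematicalPhysics.QuantumFieldTheory.Balaban1983to89.B15Prop1EndpointNearFlatLettersWindow

end
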